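import Mathlib
import Literature.NumberTheory.Transcendental.DrinfeldAssociatorEdge
import Literature.NumberTheory.Transcendental.DrinfeldAssociatorToolkit
import Literature.NumberTheory.Transcendental.DrinfeldAssociatorHolonomy
import Literature.NumberTheory.Transcendental.DrinfeldAssociator
import Literature.NumberTheory.Transcendental.AssociatorsEval

/-!
# The Drinfeld associator satisfies the pentagon equation (Drinfeld's theorem)

This file discharges the named fact `drinfeldAssociator_pentagon` of `DrinfeldAssociator.lean`:

  `theorem drinfeldAssociator_pentagon_holds : drinfeldAssociator_pentagon`,

i.e. `NCSeries.DrinfeldPentagon drinfeldAssociator` — Drinfeld's pentagon equation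
[Drinfeld1991, (2.13)] (in Furusho's form [Furusho2003, Rem. 4.3.2], [Furusho2010, (2)])

  `Φ(t₁₂,t₂₃+t₂₄) Φ(t₁₃+t₂₃,t₃₄) = Φ(t₂₃,t₃₄) Φ(t₁₂+t₁₃,t₂₄+t₃₄) Φ(t₁₂,t₂₃)`

(strands `0,1,2,3` in the Lean statement) for `Φ = Φ_KZ` DEFINED by its regularised
multiple-zeta coefficient formula (Le–Murakami / Furusho), in every weight truncation
`A_N = U𝔞₄ ⊗ ℝ/(deg > N)`.  Everything is proved; the file introduces no named fact.

## The argument formalised (Drinfeld 1991, §2, "loop-holonomy form")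

* **KZ₃ side** (`DrinfeldAssociatorTransport/Regularisation/Limit/Edge.lean`): the transport
  `S_{a,b}` of `A dt/t + B dt/(t-1)` (plus neutral letters small in `L¹`) over `[a,b] ⊂ (0,1)`
  factorises exactly as `S = exp(log((1-b)/(1-a)) y) · R · exp(log(b/a) x)` with `R = ⟨S, reg⟩`
  the IKZ-regularised series, and `R → Φ_KZ` coefficientwise with the explicit rate
  `ρ_N(a,b) = O((|log a|+2)^N a + (|log(1-b)|+2)^N (1-b))` (§2 below: `‖S - model‖_N ≤ …`).
* **KZ₄ side** (`DrinfeldAssociatorHolonomy.lean`): the KZ connection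
  `Σ dlog(ℓ) t_ℓ` over the five lines `u, 1-u, v, 1-v, v-u` of the cell `0 < u < v < 1` is flat in
  `A_N` (infinitesimal braid relations), so its transport around the closed pentagon
  `V₁=(ε²,ε), V₂=(ε-ε²,ε), V₃=(1-ε,1-ε+ε²), V₄=(1-ε,1-ε²), V₅=(ε²,1-ε²)` is trivial:
  `T(V₃→V₄)T(V₂→V₃)T(V₁→V₂) = T(V₅→V₄)T(V₁→V₅)` (§6).
* **Edges** (§7, §9, §10): along each edge the five `dlog` densities decompose over an ADAPTED
  alphabet (`f_ℓ = Σ_c m(c,ℓ) g_c`, multilinearity of Chen integrals = `push m`) with two exact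
  letters `dt/t`, `dt/(t-1)` and neutral letters of `L¹`-size `≤ 6ε`; hence each edge transport is,
  up to an error of truncated norm `O(s^k e^{-s})` (`ε = e^{-s}`), the main term
  `e^{-k_y s Z_y} Φ_KZ(Z_x, Z_y) e^{k_x s Z_x}` with `(Z_x, Z_y)` =
  `(t₀₁,t₁₂), (t₀₁+t₀₂,t₁₃+t₂₃), (t₁₂,t₂₃), (t₀₁,t₁₂+t₁₃), (t₀₂+t₁₂,t₂₃)`.
* **Main terms** (§8): by the infinitesimal braid relations alone, both edge products equal
  `N₄ · (side) · N₁⁻¹` with the SAME divergent normalisations `N₄ = e^{-s(t₁₂+t₁₃)}e^{-2st₂₃}`,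
  `N₁⁻¹ = e^{s(t₀₂+t₁₂)}e^{2st₀₁}` (Drinfeld's asymptotic zones at `V₄` and `V₁`).
* **Limit** (§4, §11, §12): hence `sideX - sideY = ev(G_s)` for a free series `G_s` of truncated
  norm `≤ (polynomial in s) · e^{-s}`; pairing with any linear functional of the finite-dimensional
  `A_N` and letting `s → ∞` gives `sideX = sideY` (`Module.forall_dual_apply_eq_zero_iff`).

## References
* V. G. Drinfel'd, *On quasitriangular quasi-Hopf algebras and on a group that is closely
  connected with Gal(Q̄/Q)*, Leningrad Math. J. 2 (1991), 829–860, §2, (2.13). [Drinfeld1991]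
* H. Furusho, *The multiple zeta value algebra and the stable derivation algebra*, Publ. RIMS 39
  (2003), 695–720, §3.2, Prop. 3.2.3, Rem. 4.3.2 (arXiv:math/0011261). [Furusho2003]
* H. Furusho, *Pentagon and hexagon equations*, Ann. of Math. 171 (2010), 545–556, (2).
  [Furusho2010]
* K. Ihara, M. Kaneko, D. Zagier, *Derivation and double shuffle relations for multiple zeta
  values*, Compos. Math. 142 (2006), §1. [IharaKanekoZagier2006]
-/

noncomputable section

open MeasureTheory intervalIntegral Set Filter Finsupp
open scoped BigOperators Topology

namespace Literature.NumberTheory.Transcendental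

namespace KZPentagon

/-! ## 1. Words in the image of the two-letter embedding -/

section BsubWords

variable {α : Type*} {x y : α}

/-- A word all of whose letters are `x` or `y` is the image of a binary word. [folklore] -/
theorem exists_map_bsub_of_forall_mem :
    ∀ {W : List α}, (∀ c ∈ W, c = x ∨ c = y) → ∃ w : List Bool, w.map (NCSeries.bsub x y) = W
  | [], _ => ⟨[], rfl⟩
  | c :: W, h => by
    obtain ⟨w, hw⟩ := exists_map_bsub_of_forall_mem (W := W) fun d hd => h d (List.mem_cons_of_mem c hd)
    rcases h c List.mem_cons_self with rfl | rfl
    · exact ⟨false :: w, by simp [hw]⟩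
    · exact ⟨true :: w, by simp [hw]⟩

/-- A word outside the image of the embedding contains a third letter. [folklore] -/
theorem exists_mem_ne_of_not_exists_map_bsub {W : List α}
    (hW : ¬ ∃ w : List Bool, w.map (NCSeries.bsub x y) = W) : ∃ c ∈ W, c ≠ x ∧ c ≠ y := by
  by_contra h
  push Not at h
  exact hW (exists_map_bsub_of_forall_mem fun c hc => by
    by_cases hcx : c = x
    · exact Or.inl hcx
    · exact Or.inr (h c hc hcx))

end BsubWords

/-! ## 2. The model of an edge transport and its distance to the transport -/

section EdgeModel

variable {α : Type*} [Fintype α] [DecidableEq α] {x y : α} (hxy : x ≠ y) {f : α → ℝ → ℝ} {η : ℝ}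
  (hη : 0 ≤ η)
  (hfx : ∀ t ∈ Ioo (0 : ℝ) 1, f x t = 1 / t) (hfy : ∀ t ∈ Ioo (0 : ℝ) 1, f y t = 1 / (t - 1))
  (hcont : ∀ c, ContinuousOn (f c) (Ioo 0 1))

/-- The regularised transport `R = (W ↦ ⟨S_{a,b}, reg_{x,y} W⟩)` of the edge. [folklore] -/
def edgeR (f : α → ℝ → ℝ) (x y : α) (a b : ℝ) : NCSeries α ℝ :=
  fun W => Shuffle.pair (transportSeries f a b) (Shuffle.reg x y W)

/-- `Φ_KZ` embedded along `false ↦ x`, `true ↦ y` (zero on words with a third letter). [folklore] -/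
def embPhi (x y : α) : NCSeries α ℝ := NCSeries.emb (NCSeries.bsub x y) drinfeldAssociator

/-- The **model** `exp(ℓ_y y) · Φ_KZ(x, y) · exp(ℓ_x x)` of an edge transport. [folklore] -/
def edgeModel (x y : α) (ℓy ℓx : ℝ) : NCSeries α ℝ :=
  Shuffle.expLetter y ℓy * embPhi x y * Shuffle.expLetter x ℓx

omit [Fintype α] in
/-- `exp(ℓ c) exp(-ℓ c) = 1`. [folklore] -/
theorem expLetter_mul_expLetter_neg (c : α) (ℓ : ℝ) :
    Shuffle.expLetter c ℓ * Shuffle.expLetter c (-ℓ) = 1 := by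
  rw [← NCSeries.expLetter_add, add_neg_cancel, NCSeries.expLetter_zero]

omit [Fintype α] in
/-- `exp(-ℓ c) exp(ℓ c) = 1`. [folklore] -/
theorem expLetter_neg_mul_expLetter (c : α) (ℓ : ℝ) :
    Shuffle.expLetter c (-ℓ) * Shuffle.expLetter c ℓ = 1 := by
  rw [← NCSeries.expLetter_add, neg_add_cancel, NCSeries.expLetter_zero]

include hxy hfx hfy hcont in
omit [Fintype α] in
/-- **Exact form of the edge transport**: `S_{a,b} = exp(log((1-b)/(1-a)) y) · R · exp(log(b/a) x)`.
[cite: Furusho2003, Prop. 3.2.3] -/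
theorem transportSeries_eq_expLetter_mul_edgeR_mul {a b : ℝ} (ha : a ∈ Ioo (0 : ℝ) 1)
    (hb : b ∈ Ioo (0 : ℝ) 1) :
    transportSeries f a b = Shuffle.expLetter y (Real.log ((1 - b) / (1 - a))) * edgeR f x y a b *
      Shuffle.expLetter x (Real.log (b / a)) := by
  have hfac := edge_factorisation hxy hcont ha hb
  rw [transportSeries_x hfx ha hb, transportSeries_y hfy ha hb] at hfac
  have hR : edgeR f x y a b = fun W => Shuffle.pair (transportSeries f a b) (Shuffle.reg x y W) := rfl
  rw [hR, ← hfac]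
  simp only [← mul_assoc, expLetter_mul_expLetter_neg, one_mul]
  simp only [mul_assoc, expLetter_neg_mul_expLetter, mul_one]

/-- The sum of the `ℓ¹`-norms of `reg_{false,true} w` over binary words of length `≤ N`. [folklore] -/
def regBoundBool (N : ℕ) : ℝ := ∑ w ∈ NCSeries.wordsLE Bool N, Shuffle.regNorm false true w

/-- The sum of the `ℓ¹`-norms of `reg_{x,y} W` over words of length `≤ N`. [folklore] -/
def regBound (x y : α) (N : ℕ) : ℝ := ∑ W ∈ NCSeries.wordsLE α N, Shuffle.regNorm x y W

omit [Fintype α] in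
/-- `regNorm w ≤ regBoundBool N` for `|w| ≤ N`. [folklore] -/
theorem regNorm_le_regBoundBool {N : ℕ} {w : List Bool} (hw : w.length ≤ N) :
    Shuffle.regNorm false true w ≤ regBoundBool N :=
  Finset.single_le_sum (f := fun w => Shuffle.regNorm false true w)
    (fun _ _ => Shuffle.regNorm_nonneg _ _ _) (NCSeries.mem_wordsLE.mpr hw)

/-- `regNorm W ≤ regBound N` for `|W| ≤ N`. [folklore] -/
theorem regNorm_le_regBound {N : ℕ} {W : List α} (hW : W.length ≤ N) :
    Shuffle.regNorm x y W ≤ regBound x y N :=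
  Finset.single_le_sum (f := fun W => Shuffle.regNorm x y W)
    (fun _ _ => Shuffle.regNorm_nonneg _ _ _) (NCSeries.mem_wordsLE.mpr hW)

omit [Fintype α] in
/-- `regBoundBool N ≥ 0`. [folklore] -/
theorem regBoundBool_nonneg (N : ℕ) : 0 ≤ regBoundBool N :=
  Finset.sum_nonneg fun _ _ => Shuffle.regNorm_nonneg _ _ _

/-- `regBound N ≥ 0`. [folklore] -/
theorem regBound_nonneg (N : ℕ) : 0 ≤ regBound x y N :=
  Finset.sum_nonneg fun _ _ => Shuffle.regNorm_nonneg _ _ _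

/-- The error scale of an edge: `#{|W| ≤ N} · (RB (N+1)² 16^N ρ_N(a,b) + RB' η (1+K)^N)`,
`K = |log a| + |log(1-b)| + η`. [folklore] -/
def edgeErr (x y : α) (N : ℕ) (η a b : ℝ) : ℝ :=
  (NCSeries.wordsLE α N).card *
    (regBoundBool N * ((N + 1) ^ 2 * 16 ^ N * KZ3.rate N a b) +
      regBound x y N * (η * (1 + (|Real.log a| + |Real.log (1 - b)| + η)) ^ N))

include hη in
/-- `edgeErr ≥ 0`. [folklore] -/
theorem edgeErr_nonneg (N : ℕ) {a b : ℝ} (ha : 0 ≤ a) (hb : b ≤ 1) : 0 ≤ edgeErr x y N η a b := by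
  unfold edgeErr
  have h1 := regBoundBool_nonneg N
  have h2 := regBound_nonneg (x := x) (y := y) N
  have h3 := KZ3.rate_nonneg N ha hb
  positivity

include hxy hfx hfy hcont hη in
/-- **The regularised transport is close to the embedded `Φ_KZ`**:
`‖R - Φ_KZ(x,y)‖_N ≤ edgeErr`. [cite: Furusho2003, Prop. 3.2.3] -/
theorem tn_edgeR_sub_embPhi_le (N : ℕ) {a b : ℝ} (ha0 : 0 < a) (ha : a < 1 / 2) (hb1 : 1 / 2 < b)
    (hb : b < 1) (hsmall : ∀ c, c ≠ x → c ≠ y → (∫ t in a..b, |f c t|) ≤ η) :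
    NCSeries.tn N (edgeR f x y a b - embPhi x y) ≤ edgeErr x y N η a b := by
  unfold NCSeries.tn edgeErr
  set A := regBoundBool N * ((N + 1) ^ 2 * 16 ^ N * KZ3.rate N a b) with hA
  set B := regBound x y N * (η * (1 + (|Real.log a| + |Real.log (1 - b)| + η)) ^ N) with hB
  have hK0 : 0 ≤ |Real.log a| + |Real.log (1 - b)| + η := by positivity
  have hA0 : 0 ≤ A := by
    have := regBoundBool_nonneg N
    have := KZ3.rate_nonneg N ha0.le hb.le
    positivity
  have hB0 : 0 ≤ B := by
    have := regBound_nonneg (x := x) (y := y) N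
    positivity
  have hterm : ∀ W ∈ NCSeries.wordsLE α N, |(edgeR f x y a b - embPhi x y) W| ≤ A + B := by
    intro W hW
    rw [NCSeries.mem_wordsLE] at hW
    rw [NCSeries.sub_apply]
    by_cases hex : ∃ w : List Bool, w.map (NCSeries.bsub x y) = W
    · obtain ⟨w, rfl⟩ := hex
      rw [List.length_map] at hW
      rw [embPhi, NCSeries.emb_map (bsub_injective hxy)]
      refine (abs_pair_reg_map_sub_drinfeldAssociator_le hxy hfx hfy ha0 ha hb1 hb w).trans ?_
      refine le_add_of_le_of_nonneg ?_ hB0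
      rw [hA]
      have h16 : (16 : ℝ) ^ w.length ≤ 16 ^ N := pow_le_pow_right₀ (by norm_num) hW
      have hN : ((w.length : ℝ) + 1) ^ 2 ≤ ((N : ℝ) + 1) ^ 2 := by
        gcongr
      have hr := KZ3.rate_mono w.length N hW ha0.le hb.le
      have hr0 := KZ3.rate_nonneg w.length ha0.le hb.le
      have hRB := regNorm_le_regBoundBool hW
      have hRB0 := Shuffle.regNorm_nonneg false true w
      have hRBB := regBoundBool_nonneg N
      gcongr
    · rw [embPhi, NCSeries.emb_eq_zero_of_not_range _ (fun w hw => hex ⟨w, hw⟩), sub_zero]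
      obtain ⟨c₀, hc₀, hcx, hcy⟩ := exists_mem_ne_of_not_exists_map_bsub hex
      refine (abs_pair_reg_le_of_neutral hη hfx hfy hcont ha0 (by linarith) hb hsmall hc₀ hcx
        hcy).trans ?_
      refine le_add_of_nonneg_of_le hA0 ?_
      rw [hB]
      have hRB := regNorm_le_regBound (x := x) (y := y) hW
      have hRB0 := Shuffle.regNorm_nonneg x y W
      have hRBB := regBound_nonneg (x := x) (y := y) N
      have hKpow : (|Real.log a| + |Real.log (1 - b)| + η) ^ (W.length - 1) ≤
          (1 + (|Real.log a| + |Real.log (1 - b)| + η)) ^ N :=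
        (pow_le_pow_left₀ hK0 (by linarith) _).trans
          (pow_le_pow_right₀ (by linarith) (by omega))
      gcongr
  refine (Finset.sum_le_sum hterm).trans ?_
  rw [Finset.sum_const, nsmul_eq_mul]

/-- The polynomial scale `P = (N+1)² (1 + 2Λ)^N` bounding all exponential factors. [folklore] -/
def expScale (N : ℕ) (Λ : ℝ) : ℝ := (N + 1) ^ 2 * (1 + 2 * Λ) ^ N

omit [Fintype α] [DecidableEq α] in
/-- `1 ≤ P`. [folklore] -/
theorem one_le_expScale (N : ℕ) {Λ : ℝ} (hΛ : 0 ≤ Λ) : 1 ≤ expScale N Λ := by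
  unfold expScale
  have h1 : (1 : ℝ) ≤ (N + 1) ^ 2 := by
    have : (1 : ℝ) ≤ N + 1 := by linarith [(Nat.cast_nonneg N : (0 : ℝ) ≤ N)]
    nlinarith
  have h2 : (1 : ℝ) ≤ (1 + 2 * Λ) ^ N := one_le_pow₀ (by linarith)
  nlinarith

/-- `‖exp(ℓ c)‖_N ≤ P` for `|ℓ| ≤ Λ`. [folklore] -/
theorem tn_expLetter_le_expScale (N : ℕ) (c : α) {ℓ Λ : ℝ} (hℓ : |ℓ| ≤ Λ) :
    NCSeries.tn N (Shuffle.expLetter c ℓ) ≤ expScale N Λ := by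
  refine (NCSeries.tn_expLetter_le N c ℓ).trans ?_
  unfold expScale
  have hΛ : 0 ≤ Λ := (abs_nonneg ℓ).trans hℓ
  have h1 : (1 + |ℓ|) ^ N ≤ (1 + 2 * Λ) ^ N :=
    pow_le_pow_left₀ (by positivity) (by linarith) _
  have h2 : ((N : ℝ) + 1) ≤ (N + 1) ^ 2 := by
    have : (1 : ℝ) ≤ N + 1 := by linarith [(Nat.cast_nonneg N : (0 : ℝ) ≤ N)]
    nlinarith
  exact mul_le_mul h2 h1 (by positivity) (by positivity)

/-- `‖exp(ℓ c) - exp(ℓ₀ c)‖_N ≤ P |ℓ - ℓ₀|` for `|ℓ|, |ℓ₀| ≤ Λ`. [folklore] -/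
theorem tn_expLetter_sub_le_expScale (N : ℕ) (c : α) {ℓ ℓ₀ Λ : ℝ} (hℓ : |ℓ| ≤ Λ) (hℓ₀ : |ℓ₀| ≤ Λ) :
    NCSeries.tn N (Shuffle.expLetter c ℓ - Shuffle.expLetter c ℓ₀) ≤ expScale N Λ * |ℓ - ℓ₀| := by
  refine (NCSeries.tn_expLetter_sub_le N c ℓ ℓ₀).trans ?_
  unfold expScale
  have hΛ : 0 ≤ Λ := (abs_nonneg ℓ).trans hℓ
  have h1 : (1 + |ℓ| + |ℓ₀|) ^ N ≤ (1 + 2 * Λ) ^ N :=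
    pow_le_pow_left₀ (by positivity) (by linarith) _
  have hN : (N : ℝ) ≤ N + 1 := by linarith
  calc ((N : ℝ) + 1) * (N * |ℓ - ℓ₀| * (1 + |ℓ| + |ℓ₀|) ^ N)
      ≤ (N + 1) * ((N + 1) * |ℓ - ℓ₀| * (1 + 2 * Λ) ^ N) := by gcongr
    _ = (N + 1) ^ 2 * (1 + 2 * Λ) ^ N * |ℓ - ℓ₀| := by ring

include hxy hfx hfy hcont hη in
/-- **The edge transport is close to its model**: with `ℓ_x = log(b/a)`, `ℓ_y = log((1-b)/(1-a))`
and model exponents `ℓx₀, ℓy₀`, all of absolute value `≤ Λ`,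
`‖S - exp(ℓy₀ y) Φ_KZ(x,y) exp(ℓx₀ x)‖_N ≤ P² ((‖Φ‖ + E)(|ℓ_x-ℓx₀| + |ℓ_y-ℓy₀|) + E)`,
`E = edgeErr`, `‖Φ‖ = ‖embPhi‖_N`. [cite: Drinfeld1991, §2] -/
theorem tn_transport_sub_edgeModel_le (N : ℕ) {a b : ℝ} (ha0 : 0 < a) (ha : a < 1 / 2)
    (hb1 : 1 / 2 < b) (hb : b < 1) (hsmall : ∀ c, c ≠ x → c ≠ y → (∫ t in a..b, |f c t|) ≤ η)
    {ℓx₀ ℓy₀ Λ : ℝ} (hΛx : |Real.log (b / a)| ≤ Λ) (hΛy : |Real.log ((1 - b) / (1 - a))| ≤ Λ)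
    (hΛx₀ : |ℓx₀| ≤ Λ) (hΛy₀ : |ℓy₀| ≤ Λ) :
    NCSeries.tn N (transportSeries f a b - edgeModel x y ℓy₀ ℓx₀) ≤
      expScale N Λ ^ 2 * ((NCSeries.tn N (embPhi x y : NCSeries α ℝ) + edgeErr x y N η a b) *
        (|Real.log (b / a) - ℓx₀| + |Real.log ((1 - b) / (1 - a)) - ℓy₀|) + edgeErr x y N η a b) := by
  have ha' : a ∈ Ioo (0 : ℝ) 1 := ⟨ha0, by linarith⟩
  have hb' : b ∈ Ioo (0 : ℝ) 1 := ⟨by linarith, hb⟩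
  set ℓx := Real.log (b / a) with hℓx
  set ℓy := Real.log ((1 - b) / (1 - a)) with hℓy
  set R := edgeR f x y a b with hRdef
  set Φ' : NCSeries α ℝ := embPhi x y with hΦ'
  set P := expScale N Λ with hP
  set E := edgeErr x y N η a b with hE
  have hS : transportSeries f a b = Shuffle.expLetter y ℓy * R * Shuffle.expLetter x ℓx :=
    transportSeries_eq_expLetter_mul_edgeR_mul hxy hfx hfy hcont ha' hb'
  have hsplit : transportSeries f a b - edgeModel x y ℓy₀ ℓx₀ =
      (Shuffle.expLetter y ℓy - Shuffle.expLetter y ℓy₀) * R * Shuffle.expLetter x ℓx +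
      Shuffle.expLetter y ℓy₀ * (R - Φ') * Shuffle.expLetter x ℓx +
      Shuffle.expLetter y ℓy₀ * Φ' * (Shuffle.expLetter x ℓx - Shuffle.expLetter x ℓx₀) := by
    rw [hS, edgeModel]
    noncomm_ring
  -- sizes of the pieces
  have hΛ : 0 ≤ Λ := (abs_nonneg _).trans hΛx₀
  have hP1 : 1 ≤ P := one_le_expScale N hΛ
  have hP0 : 0 ≤ P := zero_le_one.trans hP1
  have hE0 : 0 ≤ E := edgeErr_nonneg hη N ha0.le hb.le
  have hRE : NCSeries.tn N (R - Φ') ≤ E := tn_edgeR_sub_embPhi_le hxy hη hfx hfy hcont N ha0 ha hb1 hb hsmall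
  have hΦ0 : 0 ≤ NCSeries.tn N Φ' := NCSeries.tn_nonneg _ _
  have hR : NCSeries.tn N R ≤ NCSeries.tn N Φ' + E := by
    have h := NCSeries.tn_add_le N Φ' (R - Φ')
    rw [add_sub_cancel] at h
    exact h.trans (by linarith)
  have hey : NCSeries.tn N (Shuffle.expLetter y ℓy) ≤ P := tn_expLetter_le_expScale N y hΛy
  have hey₀ : NCSeries.tn N (Shuffle.expLetter y ℓy₀) ≤ P := tn_expLetter_le_expScale N y hΛy₀
  have hex : NCSeries.tn N (Shuffle.expLetter x ℓx) ≤ P := tn_expLetter_le_expScale N x hΛx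
  have hdy : NCSeries.tn N (Shuffle.expLetter y ℓy - Shuffle.expLetter y ℓy₀) ≤ P * |ℓy - ℓy₀| :=
    tn_expLetter_sub_le_expScale N y hΛy hΛy₀
  have hdx : NCSeries.tn N (Shuffle.expLetter x ℓx - Shuffle.expLetter x ℓx₀) ≤ P * |ℓx - ℓx₀| :=
    tn_expLetter_sub_le_expScale N x hΛx hΛx₀
  have t1 : NCSeries.tn N ((Shuffle.expLetter y ℓy - Shuffle.expLetter y ℓy₀) * R *
      Shuffle.expLetter x ℓx) ≤ P * |ℓy - ℓy₀| * (NCSeries.tn N Φ' + E) * P := by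
    refine (NCSeries.tn_mul_le _ _ _).trans ?_
    refine mul_le_mul ((NCSeries.tn_mul_le _ _ _).trans (mul_le_mul hdy hR (NCSeries.tn_nonneg _ _)
      (by positivity))) hex (NCSeries.tn_nonneg _ _) (by positivity)
  have t2 : NCSeries.tn N (Shuffle.expLetter y ℓy₀ * (R - Φ') * Shuffle.expLetter x ℓx) ≤
      P * E * P := by
    refine (NCSeries.tn_mul_le _ _ _).trans ?_
    refine mul_le_mul ((NCSeries.tn_mul_le _ _ _).trans (mul_le_mul hey₀ hRE (NCSeries.tn_nonneg _ _)
      hP0)) hex (NCSeries.tn_nonneg _ _) (by positivity)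
  have t3 : NCSeries.tn N (Shuffle.expLetter y ℓy₀ * Φ' *
      (Shuffle.expLetter x ℓx - Shuffle.expLetter x ℓx₀)) ≤ P * NCSeries.tn N Φ' * (P * |ℓx - ℓx₀|) := by
    refine (NCSeries.tn_mul_le _ _ _).trans ?_
    refine mul_le_mul ((NCSeries.tn_mul_le _ _ _).trans (mul_le_mul_of_nonneg_right hey₀ hΦ0)) hdx
      (NCSeries.tn_nonneg _ _) (by positivity)
  rw [hsplit]
  refine ((NCSeries.tn_add_le _ _ _).trans (add_le_add ((NCSeries.tn_add_le _ _ _).trans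
    (add_le_add t1 t2)) t3)).trans ?_
  have hax : 0 ≤ |ℓx - ℓx₀| := abs_nonneg _
  have hay : 0 ≤ |ℓy - ℓy₀| := abs_nonneg _
  nlinarith [mul_nonneg hP0 hE0, mul_nonneg hP0 hΦ0, mul_nonneg (mul_nonneg hP0 hP0) hE0,
    mul_nonneg (mul_nonneg hP0 hP0) (mul_nonneg hΦ0 hay), mul_nonneg (mul_nonneg hP0 hP0) (mul_nonneg hE0 hax)]

end EdgeModel

/-! ## 3. Evaluating the model in a nilpotent algebra -/

section EvalModel

variable {α : Type*}

/-- `monomial [c] ℓ = ℓ • letter c`. [folklore] -/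
theorem monomial_singleton_eq_smul_letter [DecidableEq α] (c : α) (ℓ : ℝ) :
    (NCSeries.monomial [c] ℓ : NCSeries α ℝ) = ℓ • NCSeries.letter c := by
  ext w
  simp only [NCSeries.monomial_apply, NCSeries.smul_apply, NCSeries.letter_apply, smul_eq_mul,
    mul_ite, mul_one, mul_zero]

/-- Restricting a substitution along `bsub x y` is the two-letter substitution `bsub (Z x) (Z y)`.
[folklore] -/
theorem comp_bsub {A : Type*} (Z : α → A) (x y : α) :
    Z ∘ NCSeries.bsub x y = NCSeries.bsub (Z x) (Z y) := by
  funext b; cases b <;> rfl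

variable [Fintype α] [DecidableEq α] {A : Type*} [Ring A] [Algebra ℝ A]

/-- **Exponentials of letters evaluate to truncated exponentials**:
`ev_Z(exp(ℓ c)) = e^{ℓ Z_c}` on a nilpotent substitution. [folklore] -/
theorem evalTrunc_expLetter (N : ℕ) (Z : α → A) (hZ : ∀ w : List α, N < w.length → (w.map Z).prod = 0)
    (c : α) (ℓ : ℝ) :
    NCSeries.evalTrunc N Z (Shuffle.expLetter c ℓ) = truncExp ℝ N (ℓ • Z c) := by
  rw [Shuffle.expLetter_eq_exp, NCSeries.evalTrunc_exp N Z hZ (by simp), truncExp]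
  refine Finset.sum_congr rfl fun m _ => ?_
  rw [monomial_singleton_eq_smul_letter, NCSeries.evalTrunc_smul, NCSeries.evalTrunc_letter N Z hZ]

/-- **The embedded associator evaluates to `Φ_KZ(Z_x, Z_y)`.** [folklore] -/
theorem evalTrunc_embPhi (N : ℕ) (Z : α → A) (x y : α) :
    NCSeries.evalTrunc N Z (embPhi x y) = NCSeries.subst₂ N drinfeldAssociator (Z x) (Z y) := by
  rw [embPhi, NCSeries.evalTrunc_emb, comp_bsub]

/-- **The model evaluates to `e^{ℓ_y Z_y} Φ_KZ(Z_x, Z_y) e^{ℓ_x Z_x}`.** [cite: Drinfeld1991, §2] -/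
theorem evalTrunc_edgeModel (N : ℕ) (Z : α → A) (hZ : ∀ w : List α, N < w.length → (w.map Z).prod = 0)
    (x y : α) (ℓy ℓx : ℝ) :
    NCSeries.evalTrunc N Z (edgeModel x y ℓy ℓx) = truncExp ℝ N (ℓy • Z y) *
      NCSeries.subst₂ N drinfeldAssociator (Z x) (Z y) * truncExp ℝ N (ℓx • Z x) := by
  rw [edgeModel, NCSeries.evalTrunc_mul N Z hZ, NCSeries.evalTrunc_mul N Z hZ, evalTrunc_expLetter N Z hZ,
    evalTrunc_expLetter N Z hZ, evalTrunc_embPhi]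

end EvalModel

/-! ## 4. Negligible and polynomially bounded functions of the scale parameter `s = log(1/ε)` -/

section Asymptotics

/-- `h` is NEGLIGIBLE: `s^k h(s) → 0` as `s → ∞` for every `k`. [folklore] -/
def Negl (h : ℝ → ℝ) : Prop := ∀ k : ℕ, Tendsto (fun s => s ^ k * h s) atTop (𝓝 0)

/-- `g` is POLYNOMIALLY BOUNDED: `|g(s)| ≤ C s^k` for large `s`. [folklore] -/
def PolyBd (g : ℝ → ℝ) : Prop := ∃ (k : ℕ) (C : ℝ), ∀ᶠ s in atTop, |g s| ≤ C * s ^ k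

/-- A negligible function tends to `0`. [folklore] -/
theorem Negl.tendsto {h : ℝ → ℝ} (hh : Negl h) : Tendsto h atTop (𝓝 0) := by
  simpa using hh 0

/-- `e^{-s}` is negligible. [folklore] -/
theorem negl_exp_neg : Negl fun s => Real.exp (-s) := fun k =>
  Real.tendsto_pow_mul_exp_neg_atTop_nhds_zero k

/-- Domination: `|h| ≤ h'` eventually and `h'` negligible imply `h` negligible. [folklore] -/
theorem Negl.of_le {h h' : ℝ → ℝ} (hh' : Negl h') (hle : ∀ᶠ s in atTop, |h s| ≤ h' s) : Negl h := by
  intro k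
  have h0 : Tendsto (fun s : ℝ => -(s ^ k * h' s)) atTop (𝓝 0) := by simpa using (hh' k).neg
  refine tendsto_of_tendsto_of_tendsto_of_le_of_le' h0 (hh' k) ?_ ?_
  · filter_upwards [hle, eventually_ge_atTop 0] with s hs hs0
    have := neg_abs_le (h s)
    nlinarith [pow_nonneg hs0 k]
  · filter_upwards [hle, eventually_ge_atTop 0] with s hs hs0
    have := le_abs_self (h s)
    nlinarith [pow_nonneg hs0 k]

/-- Sums of negligible functions are negligible. [folklore] -/
theorem Negl.add {h h' : ℝ → ℝ} (hh : Negl h) (hh' : Negl h') : Negl fun s => h s + h' s := by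
  intro k
  simpa [mul_add] using (hh k).add (hh' k)

/-- Constant multiples of negligible functions are negligible. [folklore] -/
theorem Negl.const_mul {h : ℝ → ℝ} (hh : Negl h) (C : ℝ) : Negl fun s => C * h s := by
  intro k
  simpa [mul_left_comm] using (hh k).const_mul C

/-- Multiplying a negligible function by a power keeps it negligible. [folklore] -/
theorem Negl.mul_pow {h : ℝ → ℝ} (hh : Negl h) (k₀ : ℕ) : Negl fun s => s ^ k₀ * h s := by
  intro k
  simpa [pow_add, mul_assoc] using hh (k + k₀)

/-- **Negligible × polynomially bounded is negligible.** [folklore] -/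
theorem Negl.mul_polyBd {h g : ℝ → ℝ} (hh : Negl h) (hg : PolyBd g) : Negl fun s => g s * h s := by
  obtain ⟨k₀, C, hC⟩ := hg
  have habs : Negl fun s => |h s| := by
    intro k
    have := (hh k).abs
    simp only [abs_zero] at this
    refine this.congr' ?_
    filter_upwards [eventually_ge_atTop 0] with s hs
    rw [abs_mul, abs_of_nonneg (pow_nonneg hs k)]
  refine Negl.of_le ((habs.const_mul |C|).mul_pow k₀) ?_
  · filter_upwards [hC, eventually_ge_atTop 0] with s hs hs0
    rw [abs_mul]
    calc |g s| * |h s| ≤ C * s ^ k₀ * |h s| := mul_le_mul_of_nonneg_right hs (abs_nonneg _)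
      _ ≤ |C| * s ^ k₀ * |h s| := by gcongr; exact le_abs_self C
      _ = s ^ k₀ * (|C| * |h s|) := by ring

/-- Polynomially bounded functions: domination. [folklore] -/
theorem PolyBd.of_le {g g' : ℝ → ℝ} (hg' : PolyBd g') (hle : ∀ᶠ s in atTop, |g s| ≤ g' s) : PolyBd g := by
  obtain ⟨k, C, hC⟩ := hg'
  exact ⟨k, C, by filter_upwards [hC, hle] with s hs hs'; exact hs'.trans ((le_abs_self _).trans hs)⟩

/-- Constants are polynomially bounded. [folklore] -/
theorem polyBd_const (c : ℝ) : PolyBd fun _ => c :=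
  ⟨0, |c|, Eventually.of_forall fun s => by simp⟩

/-- `s ↦ s` is polynomially bounded. [folklore] -/
theorem polyBd_id : PolyBd fun s => s :=
  ⟨1, 1, by filter_upwards [eventually_ge_atTop 0] with s hs; rw [abs_of_nonneg hs]; simp⟩

/-- Sums of polynomially bounded functions. [folklore] -/
theorem PolyBd.add {g g' : ℝ → ℝ} (hg : PolyBd g) (hg' : PolyBd g') : PolyBd fun s => g s + g' s := by
  obtain ⟨k, C, hC⟩ := hg
  obtain ⟨k', C', hC'⟩ := hg'
  refine ⟨k + k', |C| + |C'|, ?_⟩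
  filter_upwards [hC, hC', eventually_ge_atTop 1] with s hs hs' hs1
  have hk : s ^ k ≤ s ^ (k + k') := pow_le_pow_right₀ hs1 (by omega)
  have hk' : s ^ k' ≤ s ^ (k + k') := pow_le_pow_right₀ hs1 (by omega)
  have h0 : 0 ≤ s ^ (k + k') := by positivity
  calc |g s + g' s| ≤ |g s| + |g' s| := abs_add_le _ _
    _ ≤ C * s ^ k + C' * s ^ k' := add_le_add hs hs'
    _ ≤ |C| * s ^ (k + k') + |C'| * s ^ (k + k') := by
        refine add_le_add ?_ ?_
        · exact (mul_le_mul_of_nonneg_right (le_abs_self C) (by positivity)).trans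
            (mul_le_mul_of_nonneg_left hk (abs_nonneg C))
        · exact (mul_le_mul_of_nonneg_right (le_abs_self C') (by positivity)).trans
            (mul_le_mul_of_nonneg_left hk' (abs_nonneg C'))
    _ = (|C| + |C'|) * s ^ (k + k') := by ring

/-- Products of polynomially bounded functions. [folklore] -/
theorem PolyBd.mul {g g' : ℝ → ℝ} (hg : PolyBd g) (hg' : PolyBd g') : PolyBd fun s => g s * g' s := by
  obtain ⟨k, C, hC⟩ := hg
  obtain ⟨k', C', hC'⟩ := hg'
  refine ⟨k + k', |C| * |C'|, ?_⟩
  filter_upwards [hC, hC', eventually_ge_atTop 0] with s hs hs' hs0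
  rw [abs_mul, pow_add]
  calc |g s| * |g' s| ≤ (C * s ^ k) * (C' * s ^ k') :=
        mul_le_mul hs hs' (abs_nonneg _) ((abs_nonneg _).trans hs)
    _ ≤ (|C| * s ^ k) * (|C'| * s ^ k') := by
        refine mul_le_mul ?_ ?_ ((abs_nonneg _).trans hs') (by positivity)
        · exact mul_le_mul_of_nonneg_right (le_abs_self C) (by positivity)
        · exact mul_le_mul_of_nonneg_right (le_abs_self C') (by positivity)
    _ = |C| * |C'| * (s ^ k * s ^ k') := by ring

/-- Powers of polynomially bounded functions. [folklore] -/
theorem PolyBd.pow {g : ℝ → ℝ} (hg : PolyBd g) : ∀ n : ℕ, PolyBd fun s => g s ^ n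
  | 0 => by simpa using polyBd_const 1
  | n + 1 => by simpa [pow_succ] using (hg.pow n).mul hg

/-- Affine functions `A s + B` are polynomially bounded. [folklore] -/
theorem polyBd_affine (A B : ℝ) : PolyBd fun s => A * s + B :=
  ((polyBd_const A).mul polyBd_id).add (polyBd_const B)

/-- A constant that is bounded by a negligible function vanishes. [folklore] -/
theorem eq_zero_of_abs_le_negl {c : ℝ} {h : ℝ → ℝ} (hh : Negl h) (hle : ∀ᶠ s in atTop, |c| ≤ h s) :
    c = 0 := by
  have h1 : |c| ≤ 0 := le_of_tendsto_of_tendsto tendsto_const_nhds hh.tendsto hle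
  exact abs_nonpos_iff.mp h1

end Asymptotics

/-! ## 5. Lines in the cell and their transports -/

section Lines

/-- The `dlog` densities of the five lines along the line `τ ↦ P₀ + τ D`:
`f_ℓ(τ) = ∇ℓ·D / ℓ(P₀ + τ D)`. [folklore] -/
def lineDens (P₀ D : ℝ × ℝ) : L5 → ℝ → ℝ := fun ℓ τ => ℓ.slope D / ℓ.val (P₀ + τ • D)

/-- The parameters where all five lines are positive along `τ ↦ P₀ + τ D`. [folklore] -/
def lineDom (P₀ D : ℝ × ℝ) : Set ℝ := {τ | ∀ ℓ : L5, 0 < ℓ.val (P₀ + τ • D)}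

/-- `lineDom = segDom` of the unit segment of the line. [folklore] -/
theorem segDom_eq_lineDom (P₀ D : ℝ × ℝ) : segDom P₀ (P₀ + D) = lineDom P₀ D := by
  ext τ; simp [segDom, lineDom, add_sub_cancel_left]

/-- `lineDens = segDens` of the unit segment of the line. [folklore] -/
theorem segDens_eq_lineDens (P₀ D : ℝ × ℝ) : segDens P₀ (P₀ + D) = lineDens P₀ D := by
  funext ℓ τ; simp [segDens, lineDens, add_sub_cancel_left]

/-- The line domain is open. [folklore] -/
theorem isOpen_lineDom (P₀ D : ℝ × ℝ) : IsOpen (lineDom P₀ D) := by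
  rw [← segDom_eq_lineDom]; exact isOpen_segDom _ _

/-- The line domain is an interval. [folklore] -/
theorem ordConnected_lineDom (P₀ D : ℝ × ℝ) : (lineDom P₀ D).OrdConnected := by
  rw [← segDom_eq_lineDom]; exact ordConnected_segDom _ _

/-- The line densities are continuous on the line domain. [folklore] -/
theorem continuousOn_lineDens (P₀ D : ℝ × ℝ) (ℓ : L5) : ContinuousOn (lineDens P₀ D ℓ) (lineDom P₀ D) := by
  rw [← segDom_eq_lineDom, ← segDens_eq_lineDens]; exact continuousOn_segDens _ _ ℓ

/-- Points of the cell on the line have their parameter in the line domain. [folklore] -/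
theorem mem_lineDom_of_mem_cellU {P₀ D : ℝ × ℝ} {τ : ℝ} (h : P₀ + τ • D ∈ cellU) : τ ∈ lineDom P₀ D :=
  fun ℓ => ℓ.val_pos h

/-- **Reparametrisation**: the segment transport between two points of a line is the transport of
the line densities between their parameters. [folklore] -/
theorem segT_line {P₀ D : ℝ × ℝ} {a b : ℝ} (ha : P₀ + a • D ∈ cellU) (hb : P₀ + b • D ∈ cellU) :
    segT (P₀ + a • D) (P₀ + b • D) = transportSeries (lineDens P₀ D) a b := by
  set p := P₀ + a • D with hp
  set q := P₀ + b • D with hq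
  have hqp : q - p = (b - a) • D := by rw [hp, hq]; module
  have hpt : ∀ σ : ℝ, p + σ • (q - p) = P₀ + (a + σ * (b - a)) • D := by
    intro σ; rw [hqp, hp]; module
  -- reparametrise `τ = a + σ (b - a)`
  have hcomp := transportSeries_comp (f := lineDens P₀ D) (isOpen_lineDom P₀ D)
    (ordConnected_lineDom P₀ D) (continuousOn_lineDens P₀ D) (s' := segDom p q) (isOpen_segDom p q)
    (ordConnected_segDom p q) (φ := fun σ => a + σ * (b - a)) (φ' := fun _ => b - a)
    (fun x _ => by simpa using ((hasDerivAt_id x).mul_const (b - a)).const_add a)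
    continuousOn_const
    (fun σ hσ ℓ => by have := hσ ℓ; rwa [hpt σ] at this)
    (a := 0) (b := 1) (mem_segDom ha hb ⟨le_rfl, zero_le_one⟩) (mem_segDom ha hb ⟨zero_le_one, le_rfl⟩)
  simp only [zero_mul, add_zero, one_mul, add_sub_cancel] at hcomp
  rw [hcomp, segT]
  congr 1
  funext ℓ σ
  rw [segDens, lineDens, hpt σ, hqp, L5.slope_smul]
  ring

end Lines

/-! ## 6. The pentagon loop and its holonomy -/

section Loop

/-- The corner-cutting pentagon `V₁ ⋯ V₅` at scale `ε`. [cite: Drinfeld1991, §2] -/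
def V1 (ε : ℝ) : ℝ × ℝ := (ε ^ 2, ε)
/-- Second vertex. [cite: Drinfeld1991, §2] -/
def V2 (ε : ℝ) : ℝ × ℝ := (ε - ε ^ 2, ε)
/-- Third vertex. [cite: Drinfeld1991, §2] -/
def V3 (ε : ℝ) : ℝ × ℝ := (1 - ε, 1 - ε + ε ^ 2)
/-- Fourth vertex. [cite: Drinfeld1991, §2] -/
def V4 (ε : ℝ) : ℝ × ℝ := (1 - ε, 1 - ε ^ 2)
/-- Fifth vertex. [cite: Drinfeld1991, §2] -/
def V5 (ε : ℝ) : ℝ × ℝ := (ε ^ 2, 1 - ε ^ 2)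

variable {ε : ℝ} (hε0 : 0 < ε) (hε : ε < 1 / 2)
include hε0 hε

/-- `V₁` lies in the cell for `0 < ε < 1/2`. [folklore] -/
theorem V1_mem : V1 ε ∈ cellU := by
  refine ⟨by simp [V1]; positivity, ?_, ?_⟩ <;> simp only [V1] <;> nlinarith
/-- `V₂` lies in the cell. [folklore] -/
theorem V2_mem : V2 ε ∈ cellU := by
  refine ⟨?_, ?_, ?_⟩ <;> simp only [V2] <;> nlinarith
/-- `V₃` lies in the cell. [folklore] -/
theorem V3_mem : V3 ε ∈ cellU := by
  refine ⟨?_, ?_, ?_⟩ <;> simp only [V3] <;> nlinarith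
/-- `V₄` lies in the cell. [folklore] -/
theorem V4_mem : V4 ε ∈ cellU := by
  refine ⟨?_, ?_, ?_⟩ <;> simp only [V4] <;> nlinarith
/-- `V₅` lies in the cell. [folklore] -/
theorem V5_mem : V5 ε ∈ cellU := by
  refine ⟨?_, ?_, ?_⟩ <;> simp only [V5] <;> nlinarith

omit hε0 hε in
/-- In a monoid: `a' a = 1`, `b' b = 1`, `a b c = 1` imply `c = b' a'`. [folklore] -/
theorem eq_mul_of_mul_mul_eq_one {M : Type*} [Monoid M] {a a' b b' c : M} (ha : a' * a = 1)
    (hb : b' * b = 1) (h : a * (b * c) = 1) : c = b' * a' := by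
  calc c = b' * b * c := by rw [hb, one_mul]
    _ = b' * (a' * a) * (b * c) := by rw [ha, mul_one, mul_assoc]
    _ = b' * a' * (a * (b * c)) := by simp only [mul_assoc]
    _ = b' * a' := by rw [h, mul_one]

/-- **Holonomy of the pentagon loop**, forward edges only:
`T(V₃→V₄) T(V₂→V₃) T(V₁→V₂) = T(V₅→V₄) T(V₁→V₅)` in `A_N`. [cite: Drinfeld1991, §2] -/
theorem holonomy_VV (N : ℕ) :
    ev N (segT (V3 ε) (V4 ε)) * (ev N (segT (V2 ε) (V3 ε)) * ev N (segT (V1 ε) (V2 ε))) =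
      ev N (segT (V5 ε) (V4 ε)) * ev N (segT (V1 ε) (V5 ε)) := by
  have h := holonomy_pentagon N (V1_mem hε0 hε) (V2_mem hε0 hε) (V3_mem hε0 hε) (V4_mem hε0 hε)
    (V5_mem hε0 hε)
  simp only [mul_assoc] at h
  exact eq_mul_of_mul_mul_eq_one (ev_segT_reverse_mul N (V5_mem hε0 hε) (V1_mem hε0 hε))
    (ev_segT_reverse_mul N (V4_mem hε0 hε) (V5_mem hε0 hε)) h

end Loop

/-! ## 7. The edge package: an adapted alphabet, its transport, model and error -/

section Package

variable (N : ℕ)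

/-- The generators of an adapted alphabet: `Z_c = Σ_f m(c,f) t_f`. [folklore] -/
def Zm (m : L5 → L5 → ℝ) : L5 → A4 N := fun c => ∑ f, m c f • tOf N f

/-- The adapted generators have weight one. [folklore] -/
theorem Zm_mem_genSpan (m : L5 → L5 → ℝ) (c : L5) :
    Zm N m c ∈ (DrinfeldKohnoTrunc.genSpan : Submodule ℝ (A4 N)) :=
  Submodule.sum_mem _ fun f _ => Submodule.smul_mem _ _ (tOf_mem_genSpan N f)

/-- The adapted substitution is `(N+1)`-nilpotent. [folklore] -/
theorem Zm_nilpotent (m : L5 → L5 → ℝ) (w : List L5) (hw : N < w.length) :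
    (w.map (Zm N m)).prod = 0 :=
  DrinfeldKohnoTrunc.prod_map_eq_zero_of_mem_genSpan _ (Zm_mem_genSpan N m) w hw

/-- `ev(push m S) = ev_Z(S)`. [folklore] -/
theorem ev_push (m : L5 → L5 → ℝ) (S : NCSeries L5 ℝ) :
    ev N (NCSeries.push m S) = NCSeries.evalTrunc N (Zm N m) S :=
  NCSeries.evalTrunc_push N (tOf N) m S

/-- The analytic hypotheses of an edge of the pentagon loop: the segment from `P₀ + a D` to
`P₀ + b D` of the cell, whose `dlog` densities decompose as `f_ℓ = Σ_c m(c, ℓ) g_c` over an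
adapted alphabet with exact letters `g_x = dt/t`, `g_y = dt/(t-1)` and neutral letters of `L¹`-norm
`≤ η` on `[a, b]`. [cite: Drinfeld1991, §2] -/
structure EdgeHyp (m : L5 → L5 → ℝ) (g : L5 → ℝ → ℝ) (x y : L5) (η a b : ℝ) (P₀ D : ℝ × ℝ) : Prop where
  hxy : x ≠ y
  hη : 0 ≤ η
  hgx : ∀ t ∈ Ioo (0 : ℝ) 1, g x t = 1 / t
  hgy : ∀ t ∈ Ioo (0 : ℝ) 1, g y t = 1 / (t - 1)
  hcont : ∀ c, ContinuousOn (g c) (Ioo 0 1)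
  ha0 : 0 < a
  ha : a < 1 / 2
  hb1 : 1 / 2 < b
  hb : b < 1
  hsmall : ∀ c, c ≠ x → c ≠ y → (∫ t in a..b, |g c t|) ≤ η
  hlin : ∀ ℓ, EqOn (lineDens P₀ D ℓ) (fun t => ∑ c, m c ℓ * g c t) (uIcc a b)
  hpa : P₀ + a • D ∈ cellU
  hpb : P₀ + b • D ∈ cellU

variable {N} {m : L5 → L5 → ℝ} {g : L5 → ℝ → ℝ} {x y : L5} {η a b : ℝ} {P₀ D : ℝ × ℝ}

/-- **The edge transport is the pushed adapted transport**: `T̂(P₀+aD → P₀+bD) = push m S^g_{a,b}`.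
[folklore] -/
theorem EdgeHyp.segT_eq (H : EdgeHyp m g x y η a b P₀ D) :
    segT (P₀ + a • D) (P₀ + b • D) = NCSeries.push m (transportSeries g a b) := by
  have ha' : a ∈ Ioo (0 : ℝ) 1 := ⟨H.ha0, by linarith [H.ha]⟩
  have hb' : b ∈ Ioo (0 : ℝ) 1 := ⟨by linarith [H.ha0, H.hb1], H.hb⟩
  rw [segT_line H.hpa H.hpb, transportSeries_congr H.hlin]
  exact NCSeries.transportSeries_eq_push m isOpen_Ioo ordConnected_Ioo H.hcont ha' hb'

/-- The size of the pushed model error: `C_m^N ×` the bound of `tn_transport_sub_edgeModel_le`.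
[folklore] -/
theorem EdgeHyp.tn_sub_model_le (H : EdgeHyp m g x y η a b P₀ D) (N : ℕ) {ℓx₀ ℓy₀ Λ : ℝ}
    (hΛx : |Real.log (b / a)| ≤ Λ) (hΛy : |Real.log ((1 - b) / (1 - a))| ≤ Λ) (hΛx₀ : |ℓx₀| ≤ Λ)
    (hΛy₀ : |ℓy₀| ≤ Λ) :
    NCSeries.tn N (NCSeries.push m (transportSeries g a b) - NCSeries.push m (edgeModel x y ℓy₀ ℓx₀)) ≤
      NCSeries.pushConst m ^ N * (expScale N Λ ^ 2 *
        ((NCSeries.tn N (embPhi x y : NCSeries L5 ℝ) + edgeErr x y N η a b) *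
          (|Real.log (b / a) - ℓx₀| + |Real.log ((1 - b) / (1 - a)) - ℓy₀|) + edgeErr x y N η a b)) := by
  rw [← NCSeries.push_sub_eq]
  refine (NCSeries.tn_push_le N m _).trans (mul_le_mul_of_nonneg_left ?_ ?_)
  · exact tn_transport_sub_edgeModel_le H.hxy H.hη H.hgx H.hgy H.hcont N H.ha0 H.ha H.hb1 H.hb
      H.hsmall hΛx hΛy hΛx₀ hΛy₀
  · exact pow_nonneg (zero_le_one.trans (NCSeries.one_le_pushConst m)) N

/-- **The pushed model evaluates to `e^{ℓy₀ Z_y} Φ_KZ(Z_x, Z_y) e^{ℓx₀ Z_x}`.** [cite: Drinfeld1991, §2] -/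
theorem ev_push_edgeModel (N : ℕ) (m : L5 → L5 → ℝ) (x y : L5) (ℓy₀ ℓx₀ : ℝ) :
    ev N (NCSeries.push m (edgeModel x y ℓy₀ ℓx₀)) = truncExp ℝ N (ℓy₀ • Zm N m y) *
      NCSeries.subst₂ N drinfeldAssociator (Zm N m x) (Zm N m y) * truncExp ℝ N (ℓx₀ • Zm N m x) := by
  rw [ev_push, evalTrunc_edgeModel N (Zm N m) (Zm_nilpotent N m)]

/-- The size of the pushed model: `‖push m (model)‖_N ≤ C_m^N P² ‖Φ‖`. [folklore] -/
theorem tn_push_edgeModel_le (N : ℕ) (m : L5 → L5 → ℝ) (x y : L5) {ℓy₀ ℓx₀ Λ : ℝ} (hΛx₀ : |ℓx₀| ≤ Λ)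
    (hΛy₀ : |ℓy₀| ≤ Λ) :
    NCSeries.tn N (NCSeries.push m (edgeModel x y ℓy₀ ℓx₀)) ≤
      NCSeries.pushConst m ^ N * (expScale N Λ ^ 2 * NCSeries.tn N (embPhi x y : NCSeries L5 ℝ)) := by
  refine (NCSeries.tn_push_le N m _).trans (mul_le_mul_of_nonneg_left ?_
    (pow_nonneg (zero_le_one.trans (NCSeries.one_le_pushConst m)) N))
  unfold edgeModel
  have hP0 : 0 ≤ expScale N Λ := zero_le_one.trans (one_le_expScale N ((abs_nonneg _).trans hΛx₀))
  calc NCSeries.tn N (Shuffle.expLetter y ℓy₀ * embPhi x y * Shuffle.expLetter x ℓx₀)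
      ≤ NCSeries.tn N (Shuffle.expLetter y ℓy₀ * embPhi x y) * NCSeries.tn N (Shuffle.expLetter x ℓx₀) :=
        NCSeries.tn_mul_le _ _ _
    _ ≤ (expScale N Λ * NCSeries.tn N (embPhi x y : NCSeries L5 ℝ)) * expScale N Λ :=
        mul_le_mul ((NCSeries.tn_mul_le _ _ _).trans (mul_le_mul_of_nonneg_right
          (tn_expLetter_le_expScale N y hΛy₀) (NCSeries.tn_nonneg _ _)))
          (tn_expLetter_le_expScale N x hΛx₀) (NCSeries.tn_nonneg _ _)
          (mul_nonneg hP0 (NCSeries.tn_nonneg _ _))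
    _ = expScale N Λ ^ 2 * NCSeries.tn N (embPhi x y : NCSeries L5 ℝ) := by ring

end Package

/-! ## 8. Main-term algebra in the truncated Drinfeld–Kohno algebra -/

section Algebra

variable (N : ℕ)

/-- Shorthand for the generators `t_ij ∈ A_N`. [folklore] -/
abbrev tt (i j : Fin 4) : A4 N := DrinfeldKohnoTrunc.t ℝ N i j

/-- Shorthand for the truncated exponential in `A_N`. [folklore] -/
abbrev EE (a : A4 N) : A4 N := truncExp ℝ N a

/-- The generators have weight one. [folklore] -/
theorem tt_mem (i j : Fin 4) : tt N i j ∈ (DrinfeldKohnoTrunc.genSpan : Submodule ℝ (A4 N)) :=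
  DrinfeldKohnoTrunc.t_mem_genSpan i j

variable {N}

/-- Weight-one elements are `(N+1)`-nilpotent. [folklore] -/
theorem pow_succ_eq_zero_of_mem {a : A4 N} (ha : a ∈ (DrinfeldKohnoTrunc.genSpan : Submodule ℝ (A4 N))) :
    a ^ (N + 1) = 0 :=
  DrinfeldKohnoTrunc.pow_eq_zero_of_mem_genSpan ha

/-- `e^{a+b} = e^a e^b` for commuting weight-one elements. [folklore] -/
theorem EE_add {a b : A4 N} (hab : Commute a b) (ha : a ∈ (DrinfeldKohnoTrunc.genSpan : Submodule ℝ (A4 N)))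
    (hb : b ∈ (DrinfeldKohnoTrunc.genSpan : Submodule ℝ (A4 N))) : EE N (a + b) = EE N a * EE N b :=
  truncExp_add_of_commute N hab (pow_succ_eq_zero_of_mem ha) (pow_succ_eq_zero_of_mem hb)
    (pow_succ_eq_zero_of_mem (Submodule.add_mem _ ha hb))

/-- Exponentials of commuting elements commute. [folklore] -/
theorem commute_EE_EE {a b : A4 N} (hab : Commute a b) : Commute (EE N a) (EE N b) :=
  (Commute.truncExp_right (Commute.truncExp_right hab N).symm N).symm

/-- `e^{a}` commutes with what `a` commutes with. [folklore] -/
theorem commute_EE_left {a x : A4 N} (h : Commute a x) : Commute (EE N a) x :=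
  (Commute.truncExp_right h.symm N).symm

/-- Merging: `P e^{r a} e^{s a} = P e^{(r+s) a}` for weight-one `a`. [folklore] -/
theorem mul_EE_smul_mul_EE_smul (P : A4 N) {a : A4 N} (ha : a ∈ (DrinfeldKohnoTrunc.genSpan : Submodule ℝ (A4 N)))
    (r s : ℝ) : P * EE N (r • a) * EE N (s • a) = P * EE N ((r + s) • a) := by
  rw [mul_assoc, add_smul, EE_add ((Commute.refl a).smul_left r |>.smul_right s)
    (Submodule.smul_mem _ _ ha) (Submodule.smul_mem _ _ ha)]

/-- `e^{r a} e^{s a} = e^{(r+s) a}` for weight-one `a`. [folklore] -/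
theorem EE_smul_mul_EE_smul {a : A4 N} (ha : a ∈ (DrinfeldKohnoTrunc.genSpan : Submodule ℝ (A4 N)))
    (r s : ℝ) : EE N (r • a) * EE N (s • a) = EE N ((r + s) • a) := by
  simpa using mul_EE_smul_mul_EE_smul 1 ha r s

/-- `e^{r a} e^{-r a} = 1`. [folklore] -/
theorem EE_smul_mul_EE_neg_smul {a : A4 N} (ha : a ∈ (DrinfeldKohnoTrunc.genSpan : Submodule ℝ (A4 N)))
    (r : ℝ) : EE N (r • a) * EE N ((-r) • a) = 1 := by
  rw [EE_smul_mul_EE_smul ha, add_neg_cancel, zero_smul]; exact truncExp_zero N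

/-- An element commuting with `a` and `b` commutes with `Φ(a, b)`. [folklore] -/
theorem commute_subst₂ {x a b : A4 N} (ha : Commute x a) (hb : Commute x b) (φ : NCSeries Bool ℝ) :
    Commute x (NCSeries.subst₂ N φ a b) :=
  NCSeries.commute_evalTrunc_bsub ha hb N φ

/-! ### The infinitesimal braid relations used -/

/-- `[t₁₂, t₀₁ + t₀₂] = 0`. [cite: Drinfeld1991, §2] -/
theorem comm_12_01_02 : Commute (tt N 1 2) (tt N 0 1 + tt N 0 2) := by
  have h := DrinfeldKohnoTrunc.t_mul_add (R := ℝ) (N := N) (1 : Fin 4) 2 0 (by decide) (by decide)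
    (by decide)
  rw [DrinfeldKohnoTrunc.t_symm 1 0, DrinfeldKohnoTrunc.t_symm 2 0] at h
  exact h

/-- `[t₁₂, t₁₃ + t₂₃] = 0`. [cite: Drinfeld1991, §2] -/
theorem comm_12_13_23 : Commute (tt N 1 2) (tt N 1 3 + tt N 2 3) :=
  DrinfeldKohnoTrunc.t_mul_add (R := ℝ) (N := N) (1 : Fin 4) 2 3 (by decide) (by decide) (by decide)

/-- `[t₀₁, t₀₂ + t₁₂] = 0`. [cite: Drinfeld1991, §2] -/
theorem comm_01_02_12 : Commute (tt N 0 1) (tt N 0 2 + tt N 1 2) :=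
  DrinfeldKohnoTrunc.t_mul_add (R := ℝ) (N := N) (0 : Fin 4) 1 2 (by decide) (by decide) (by decide)

/-- `[t₀₁, t₂₃] = 0`. [cite: Drinfeld1991, §2] -/
theorem comm_01_23 : Commute (tt N 0 1) (tt N 2 3) :=
  DrinfeldKohnoTrunc.t_comm (R := ℝ) (N := N) (0 : Fin 4) 1 2 3 (by decide) (by decide) (by decide)
    (by decide) (by decide) (by decide)

/-- `[t₂₃, t₁₂ + t₁₃] = 0`. [cite: Drinfeld1991, §2] -/
theorem comm_23_12_13 : Commute (tt N 2 3) (tt N 1 2 + tt N 1 3) := by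
  have h := DrinfeldKohnoTrunc.t_mul_add (R := ℝ) (N := N) (2 : Fin 4) 3 1 (by decide) (by decide)
    (by decide)
  rw [DrinfeldKohnoTrunc.t_symm 2 1, DrinfeldKohnoTrunc.t_symm 3 1] at h
  exact h

/-! ### The two main-term identities -/

/-- **Right-hand side main terms**: with `Φ₁ = Φ(t₀₁,t₁₂)`, `Φ₂ = Φ(t₀₁+t₀₂, t₁₃+t₂₃)`,
`Φ₃ = Φ(t₁₂,t₂₃)`,
`e^{-Lt₂₃} Φ₃ e^{Lt₁₂} · e^{-L(t₁₃+t₂₃)} Φ₂ e^{L(t₀₁+t₀₂)} · e^{-Lt₁₂} Φ₁ e^{Lt₀₁}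
 = e^{-L(t₁₂+t₁₃)} e^{-2Lt₂₃} · Φ₃Φ₂Φ₁ · e^{L(t₀₂+t₁₂)} e^{2Lt₀₁}`. [cite: Drinfeld1991, §2] -/
theorem main_terms_rhs (L : ℝ) (φ : NCSeries Bool ℝ) :
    EE N ((-L) • tt N 2 3) * NCSeries.subst₂ N φ (tt N 1 2) (tt N 2 3) * EE N (L • tt N 1 2) *
      (EE N ((-L) • (tt N 1 3 + tt N 2 3)) * NCSeries.subst₂ N φ (tt N 0 1 + tt N 0 2) (tt N 1 3 + tt N 2 3) *
        EE N (L • (tt N 0 1 + tt N 0 2)) *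
      (EE N ((-L) • tt N 1 2) * NCSeries.subst₂ N φ (tt N 0 1) (tt N 1 2) * EE N (L • tt N 0 1))) =
    EE N ((-L) • (tt N 1 2 + tt N 1 3)) * EE N ((-(2 * L)) • tt N 2 3) *
      (NCSeries.subst₂ N φ (tt N 1 2) (tt N 2 3) * NCSeries.subst₂ N φ (tt N 0 1 + tt N 0 2) (tt N 1 3 + tt N 2 3) *
        NCSeries.subst₂ N φ (tt N 0 1) (tt N 1 2)) *
      (EE N (L • (tt N 0 2 + tt N 1 2)) * EE N ((2 * L) • tt N 0 1)) := by
  -- names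
  set a := tt N 0 1 with ha_def
  set b := tt N 0 2 with hb_def
  set c := tt N 1 2 with hc_def
  set d := tt N 1 3 with hd_def
  set e := tt N 2 3 with he_def
  have ha : a ∈ (DrinfeldKohnoTrunc.genSpan : Submodule ℝ (A4 N)) := tt_mem N 0 1
  have hb : b ∈ (DrinfeldKohnoTrunc.genSpan : Submodule ℝ (A4 N)) := tt_mem N 0 2
  have hc : c ∈ (DrinfeldKohnoTrunc.genSpan : Submodule ℝ (A4 N)) := tt_mem N 1 2
  have hd : d ∈ (DrinfeldKohnoTrunc.genSpan : Submodule ℝ (A4 N)) := tt_mem N 1 3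
  have he : e ∈ (DrinfeldKohnoTrunc.genSpan : Submodule ℝ (A4 N)) := tt_mem N 2 3
  set Φ₁ := NCSeries.subst₂ N φ a c
  set Φ₂ := NCSeries.subst₂ N φ (a + b) (d + e)
  set Φ₃ := NCSeries.subst₂ N φ c e
  -- relations
  have F1 : Commute c (a + b) := comm_12_01_02
  have F2 : Commute c (d + e) := comm_12_13_23
  have F3 : Commute a (b + c) := comm_01_02_12
  have F6 : Commute e (c + d) := comm_23_12_13
  set cc := a + b + c with hcc
  set cc' := c + d + e with hcc'
  have hccm : cc ∈ (DrinfeldKohnoTrunc.genSpan : Submodule ℝ (A4 N)) :=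
    Submodule.add_mem _ (Submodule.add_mem _ ha hb) hc
  have hcc'm : cc' ∈ (DrinfeldKohnoTrunc.genSpan : Submodule ℝ (A4 N)) :=
    Submodule.add_mem _ (Submodule.add_mem _ hc hd) he
  have Ccc_c : Commute cc c := by
    have h1 : Commute (a + b) c := F1.symm
    exact h1.add_left (Commute.refl c)
  have Ccc_a : Commute cc a := by
    have h1 : Commute (b + c) a := F3.symm
    rw [hcc, add_assoc]; exact (Commute.refl a).add_left h1
  have Ccc'_c : Commute cc' c := by
    have h1 : Commute (d + e) c := F2.symm
    rw [hcc', add_assoc]; exact (Commute.refl c).add_left h1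
  have Ccc'_e : Commute cc' e := by
    have h1 : Commute (c + d) e := F6.symm
    exact h1.add_left (Commute.refl e)
  -- step 1: e^{L(a+b)} = e^{L cc} e^{-L c}
  have hsplit1 : EE N (L • (a + b)) = EE N (L • cc) * EE N ((-L) • c) := by
    rw [← EE_add ((Ccc_c.smul_left L).smul_right (-L)) (Submodule.smul_mem _ _ hccm)
      (Submodule.smul_mem _ _ hc)]
    congr 1; rw [hcc]; module
  -- step 4: e^{L cc} = e^{L a} e^{L (b+c)}
  have hsplit2 : EE N (L • cc) = EE N (L • a) * EE N (L • (b + c)) := by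
    rw [← EE_add ((F3.smul_left L).smul_right L) (Submodule.smul_mem _ _ ha)
      (Submodule.smul_mem _ _ (Submodule.add_mem _ hb hc))]
    congr 1; rw [hcc]; module
  -- step 7: e^{-L(d+e)} e^{-L c} = e^{-L cc'}
  have hmerge3 : ∀ P : A4 N, P * EE N ((-L) • (d + e)) * EE N ((-L) • c) = P * EE N ((-L) • cc') := by
    intro P
    rw [mul_assoc, ← EE_add ((F2.symm.smul_left (-L)).smul_right (-L))
      (Submodule.smul_mem _ _ (Submodule.add_mem _ hd he)) (Submodule.smul_mem _ _ hc)]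
    congr 2; rw [hcc']; module
  -- step 9: e^{-L cc'} = e^{-L (c+d)} e^{-L e}
  have hsplit4 : EE N ((-L) • cc') = EE N ((-L) • (c + d)) * EE N ((-L) • e) := by
    rw [← EE_add ((F6.symm.smul_left (-L)).smul_right (-L))
      (Submodule.smul_mem _ _ (Submodule.add_mem _ hc hd)) (Submodule.smul_mem _ _ he)]
    congr 1; rw [hcc']; module
  -- commutation of exponentials / Φ's
  have K1 : Commute (EE N (L • cc)) (EE N ((-(2 * L)) • c)) :=
    commute_EE_EE ((Ccc_c.smul_left L).smul_right _)
  have K2 : Commute (EE N (L • cc)) Φ₁ :=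
    commute_subst₂ (commute_EE_left (Ccc_a.symm.smul_right L).symm)
      (commute_EE_left (Ccc_c.symm.smul_right L).symm) φ
  have K3 : Commute (EE N (L • cc)) (EE N (L • a)) := commute_EE_EE ((Ccc_a.smul_left L).smul_right L)
  have K4 : Commute (EE N ((2 * L) • a)) (EE N (L • (b + c))) :=
    commute_EE_EE ((F3.smul_left _).smul_right L)
  have K5 : Commute (EE N (L • c)) (EE N ((-L) • (d + e))) :=
    commute_EE_EE ((F2.smul_left L).smul_right (-L))
  have K6 : Commute (EE N (L • c)) Φ₂ :=
    commute_subst₂ (commute_EE_left (F1.smul_left L)) (commute_EE_left (F2.smul_left L)) φ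
  have K7 : Commute Φ₂ (EE N ((-L) • c)) :=
    (commute_subst₂ (commute_EE_left (F1.smul_left (-L))) (commute_EE_left (F2.smul_left (-L))) φ).symm
  have K8 : Commute Φ₃ (EE N ((-L) • cc')) :=
    (commute_subst₂ (commute_EE_left (Ccc'_c.smul_left (-L))) (commute_EE_left (Ccc'_e.smul_left (-L)))
      φ).symm
  have K9 : Commute (EE N ((-L) • e)) (EE N ((-L) • (c + d))) :=
    commute_EE_EE ((F6.smul_left (-L)).smul_right (-L))
  -- the computation, on left-nested words
  simp only [← mul_assoc]
  rw [hsplit1]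
  simp only [← mul_assoc]
  -- word: E(-Le) Φ₃ E(Lc) E(-L(d+e)) Φ₂ E(Lcc) E(-Lc) E(-Lc) Φ₁ E(La)
  rw [mul_EE_smul_mul_EE_smul _ hc (-L) (-L), show (-L) + (-L) = -(2 * L) by ring]
  -- move E(Lcc) to the right end
  rw [K1.right_comm, K2.right_comm, K3.right_comm]
  -- word: ... Φ₂ E(-2Lc) Φ₁ E(La) E(Lcc); split E(Lcc) and merge
  rw [hsplit2, ← mul_assoc, mul_EE_smul_mul_EE_smul _ ha L L, show L + L = 2 * L by ring, K4.right_comm]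
  -- word: E(-Le) Φ₃ E(Lc) E(-L(d+e)) Φ₂ E(-2Lc) Φ₁ E(L(b+c)) E(2La); move E(Lc) right and merge
  rw [K5.right_comm, K6.right_comm, mul_EE_smul_mul_EE_smul _ hc L (-(2 * L)),
    show L + (-(2 * L)) = -L by ring]
  -- word: E(-Le) Φ₃ E(-L(d+e)) Φ₂ E(-Lc) Φ₁ ...; move E(-Lc) left past Φ₂ and merge with E(-L(d+e))
  rw [K7.right_comm, hmerge3]
  -- word: E(-Le) Φ₃ E(-Lcc') Φ₂ Φ₁ ...; swap Φ₃ and E(-Lcc'), split, reorder, merge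
  rw [K8.right_comm, hsplit4, ← mul_assoc, K9.eq, mul_EE_smul_mul_EE_smul _ he (-L) (-L),
    show (-L) + (-L) = -(2 * L) by ring]

/-- **Left-hand side main terms**: with `Φ₄ = Φ(t₀₁, t₁₂+t₁₃)`, `Φ₅ = Φ(t₀₂+t₁₂, t₂₃)`,
`e^{-L(t₁₂+t₁₃)} Φ₄ e^{2Lt₀₁} · e^{-2Lt₂₃} Φ₅ e^{L(t₀₂+t₁₂)}
 = e^{-L(t₁₂+t₁₃)} e^{-2Lt₂₃} · Φ₄Φ₅ · e^{L(t₀₂+t₁₂)} e^{2Lt₀₁}`. [cite: Drinfeld1991, §2] -/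
theorem main_terms_lhs (L : ℝ) (φ : NCSeries Bool ℝ) :
    EE N ((-L) • (tt N 1 2 + tt N 1 3)) * NCSeries.subst₂ N φ (tt N 0 1) (tt N 1 2 + tt N 1 3) *
        EE N ((2 * L) • tt N 0 1) *
      (EE N ((-(2 * L)) • tt N 2 3) * NCSeries.subst₂ N φ (tt N 0 2 + tt N 1 2) (tt N 2 3) *
        EE N (L • (tt N 0 2 + tt N 1 2))) =
    EE N ((-L) • (tt N 1 2 + tt N 1 3)) * EE N ((-(2 * L)) • tt N 2 3) *
      (NCSeries.subst₂ N φ (tt N 0 1) (tt N 1 2 + tt N 1 3) * NCSeries.subst₂ N φ (tt N 0 2 + tt N 1 2) (tt N 2 3)) *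
      (EE N (L • (tt N 0 2 + tt N 1 2)) * EE N ((2 * L) • tt N 0 1)) := by
  set a := tt N 0 1
  set b := tt N 0 2
  set c := tt N 1 2
  set d := tt N 1 3
  set e := tt N 2 3
  set Φ₄ := NCSeries.subst₂ N φ a (c + d)
  set Φ₅ := NCSeries.subst₂ N φ (b + c) e
  have F3 : Commute a (b + c) := comm_01_02_12
  have F5 : Commute a e := comm_01_23
  have F6 : Commute e (c + d) := comm_23_12_13
  have K1 : Commute (EE N ((2 * L) • a)) (EE N ((-(2 * L)) • e)) :=
    commute_EE_EE ((F5.smul_left _).smul_right _)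
  have K2 : Commute Φ₄ (EE N ((-(2 * L)) • e)) :=
    (commute_subst₂ (commute_EE_left (F5.symm.smul_left _)) (commute_EE_left (F6.smul_left _)) φ).symm
  have K3 : Commute (EE N ((2 * L) • a)) Φ₅ :=
    commute_subst₂ (commute_EE_left (F3.smul_left _)) (commute_EE_left (F5.smul_left _)) φ
  have K4 : Commute (EE N ((2 * L) • a)) (EE N (L • (b + c))) :=
    commute_EE_EE ((F3.smul_left _).smul_right L)
  simp only [← mul_assoc]
  -- word: E(-L(c+d)) Φ₄ E(2La) E(-2Le) Φ₅ E(L(b+c))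
  rw [K1.right_comm, K2.right_comm, K3.right_comm, K4.right_comm]

/-- **Conjugating away the normalisations**: from the two exact edge-product identities, the
difference of the pentagon's sides is the conjugate of the difference of the products.
[cite: Drinfeld1991, §2] -/
theorem pentagon_sides_sub_eq (L : ℝ) (φ : NCSeries Bool ℝ) (M₁ M₂ M₃ M₄ M₅ : A4 N)
    (h₁ : M₁ = EE N ((-L) • tt N 1 2) * NCSeries.subst₂ N φ (tt N 0 1) (tt N 1 2) * EE N (L • tt N 0 1))
    (h₂ : M₂ = EE N ((-L) • (tt N 1 3 + tt N 2 3)) *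
      NCSeries.subst₂ N φ (tt N 0 1 + tt N 0 2) (tt N 1 3 + tt N 2 3) * EE N (L • (tt N 0 1 + tt N 0 2)))
    (h₃ : M₃ = EE N ((-L) • tt N 2 3) * NCSeries.subst₂ N φ (tt N 1 2) (tt N 2 3) * EE N (L • tt N 1 2))
    (h₄ : M₄ = EE N ((-L) • (tt N 1 2 + tt N 1 3)) * NCSeries.subst₂ N φ (tt N 0 1) (tt N 1 2 + tt N 1 3) *
      EE N ((2 * L) • tt N 0 1))
    (h₅ : M₅ = EE N ((-(2 * L)) • tt N 2 3) * NCSeries.subst₂ N φ (tt N 0 2 + tt N 1 2) (tt N 2 3) *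
      EE N (L • (tt N 0 2 + tt N 1 2))) :
    NCSeries.subst₂ N φ (tt N 1 2) (tt N 2 3) * NCSeries.subst₂ N φ (tt N 0 1 + tt N 0 2) (tt N 1 3 + tt N 2 3) *
        NCSeries.subst₂ N φ (tt N 0 1) (tt N 1 2) -
      NCSeries.subst₂ N φ (tt N 0 1) (tt N 1 2 + tt N 1 3) * NCSeries.subst₂ N φ (tt N 0 2 + tt N 1 2) (tt N 2 3) =
    (EE N ((2 * L) • tt N 2 3) * EE N (L • (tt N 1 2 + tt N 1 3))) * (M₃ * (M₂ * M₁) - M₄ * M₅) *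
      (EE N ((-(2 * L)) • tt N 0 1) * EE N ((-L) • (tt N 0 2 + tt N 1 2))) := by
  have hR := main_terms_rhs (N := N) L φ
  have hL := main_terms_lhs (N := N) L φ
  rw [← h₁, ← h₂, ← h₃] at hR
  rw [← h₄, ← h₅] at hL
  set X := NCSeries.subst₂ N φ (tt N 1 2) (tt N 2 3) * NCSeries.subst₂ N φ (tt N 0 1 + tt N 0 2) (tt N 1 3 + tt N 2 3) *
        NCSeries.subst₂ N φ (tt N 0 1) (tt N 1 2)
  set Y := NCSeries.subst₂ N φ (tt N 0 1) (tt N 1 2 + tt N 1 3) * NCSeries.subst₂ N φ (tt N 0 2 + tt N 1 2) (tt N 2 3)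
  set N₄ := EE N ((-L) • (tt N 1 2 + tt N 1 3)) * EE N ((-(2 * L)) • tt N 2 3)
  set N₁i := EE N (L • (tt N 0 2 + tt N 1 2)) * EE N ((2 * L) • tt N 0 1)
  set N₄i := EE N ((2 * L) • tt N 2 3) * EE N (L • (tt N 1 2 + tt N 1 3))
  set N₁ := EE N ((-(2 * L)) • tt N 0 1) * EE N ((-L) • (tt N 0 2 + tt N 1 2))
  have h12 := tt_mem N 1 2; have h13 := tt_mem N 1 3; have h23 := tt_mem N 2 3
  have h01 := tt_mem N 0 1; have h02 := tt_mem N 0 2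
  have hN4 : N₄i * N₄ = 1 := by
    simp only [N₄i, N₄, ← mul_assoc]
    rw [mul_EE_smul_mul_EE_smul _ (Submodule.add_mem _ h12 h13) L (-L), add_neg_cancel, zero_smul,
      show EE N (0 : A4 N) = 1 from truncExp_zero N, mul_one, EE_smul_mul_EE_neg_smul h23]
  have hN1 : N₁i * N₁ = 1 := by
    simp only [N₁i, N₁, ← mul_assoc]
    rw [mul_EE_smul_mul_EE_smul _ h01 (2 * L) (-(2 * L)), add_neg_cancel, zero_smul,
      show EE N (0 : A4 N) = 1 from truncExp_zero N, mul_one, EE_smul_mul_EE_neg_smul (Submodule.add_mem _ h02 h12)]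
  have hR' : M₃ * (M₂ * M₁) = N₄ * X * N₁i := by rw [hR]
  have hL' : M₄ * M₅ = N₄ * Y * N₁i := by rw [hL]
  rw [hR', hL']
  calc X - Y = (N₄i * N₄) * (X - Y) * (N₁i * N₁) := by rw [hN4, hN1, one_mul, mul_one]
    _ = N₄i * (N₄ * X * N₁i - N₄ * Y * N₁i) * N₁ := by noncomm_ring

end Algebra

/-! ## 9. Elementary analysis of the edge densities -/

section EdgeAnalysis

/-- `|log(1 - u)| ≤ 2u` for `0 ≤ u ≤ 1/2`. [folklore] -/
theorem abs_log_one_sub_le {u : ℝ} (hu0 : 0 ≤ u) (hu : u ≤ 1 / 2) : |Real.log (1 - u)| ≤ 2 * u := by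
  have h1 : 0 < 1 - u := by linarith
  have hle : Real.log (1 - u) ≤ 0 := Real.log_nonpos (by linarith) (by linarith)
  rw [abs_of_nonpos hle]
  have h2 : Real.log (1 - u)⁻¹ ≤ (1 - u)⁻¹ - 1 := Real.log_le_sub_one_of_pos (inv_pos.mpr h1)
  rw [Real.log_inv] at h2
  have h3 : (1 - u)⁻¹ - 1 ≤ 2 * u := by
    rw [inv_eq_one_div, div_sub_one h1.ne', div_le_iff₀ h1]
    nlinarith
  linarith

/-- The perturbation `θ(c₀, t) = 1/(t + c₀) - 1/t` of the density `dt/t` by a shift of its pole.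
[folklore] -/
def pert (c₀ t : ℝ) : ℝ := 1 / (t + c₀) - 1 / t

/-- Its primitive `log(t + c₀) - log t`. [folklore] -/
def pertPrim (c₀ t : ℝ) : ℝ := Real.log (t + c₀) - Real.log t

/-- `(log(t + c₀) - log t)' = θ(c₀, t)`. [folklore] -/
theorem hasDerivAt_pertPrim {c₀ t : ℝ} (h1 : t + c₀ ≠ 0) (h2 : t ≠ 0) :
    HasDerivAt (pertPrim c₀) (pert c₀ t) t := by
  unfold pertPrim pert
  have ha : HasDerivAt (fun x => Real.log (x + c₀)) (1 / (t + c₀)) t := by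
    have h := (Real.hasDerivAt_log h1).comp t ((hasDerivAt_id t).add_const c₀)
    rw [one_div]
    simpa [Function.comp_def] using h
  have hb : HasDerivAt Real.log (1 / t) t := by rw [one_div]; exact Real.hasDerivAt_log h2
  exact ha.sub hb

/-- `θ(c₀, ·)` is continuous away from its poles. [folklore] -/
theorem continuousOn_pert {c₀ : ℝ} {S : Set ℝ} (h : ∀ t ∈ S, t ≠ 0 ∧ t + c₀ ≠ 0) :
    ContinuousOn (pert c₀) S := by
  unfold pert
  refine ContinuousOn.sub ?_ ?_
  · exact continuousOn_const.div (continuousOn_id.add continuousOn_const) fun t ht => (h t ht).2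
  · exact continuousOn_const.div continuousOn_id fun t ht => (h t ht).1

/-- **`L¹`-norm of the perturbation** on an interval where `t (t + c₀) > 0` (constant sign):
`∫_a^b |θ| = |[log(t + c₀) - log t]_a^b|`. [folklore] -/
theorem integral_abs_pert {c₀ a b : ℝ} (hab : a ≤ b) (hsign : ∀ t ∈ Icc a b, 0 < t * (t + c₀)) :
    ∫ t in a..b, |pert c₀ t| = |pertPrim c₀ b - pertPrim c₀ a| := by
  have hne : ∀ t ∈ Icc a b, t ≠ 0 ∧ t + c₀ ≠ 0 := fun t ht => by
    have := hsign t ht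
    constructor <;> intro h0 <;> simp [h0] at this
  have hcont : ContinuousOn (pert c₀) (Icc a b) := continuousOn_pert hne
  have hderiv : ∀ t ∈ uIcc a b, HasDerivAt (pertPrim c₀) (pert c₀ t) t := fun t ht => by
    rw [uIcc_of_le hab] at ht
    exact hasDerivAt_pertPrim (hne t ht).2 (hne t ht).1
  have hint : IntervalIntegrable (pert c₀) volume a b :=
    (hcont.mono (by rw [uIcc_of_le hab])).intervalIntegrable
  have hftc : ∫ t in a..b, pert c₀ t = pertPrim c₀ b - pertPrim c₀ a :=
    integral_eq_sub_of_hasDerivAt hderiv hint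
  -- the sign of `θ = -c₀ / (t (t + c₀))`
  have hval : ∀ t ∈ Icc a b, pert c₀ t = -c₀ / (t * (t + c₀)) := fun t ht => by
    have h := hne t ht
    rw [pert, div_sub_div _ _ h.2 h.1, mul_comm (t + c₀) t]
    congr 1; ring
  rcases le_or_gt 0 c₀ with hc | hc
  · -- θ ≤ 0
    have hnp : ∀ t ∈ Icc a b, pert c₀ t ≤ 0 := fun t ht => by
      rw [hval t ht]; exact div_nonpos_of_nonpos_of_nonneg (by linarith) (hsign t ht).le
    have h1 : ∫ t in a..b, |pert c₀ t| = ∫ t in a..b, -pert c₀ t :=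
      integral_congr fun t ht => by
        rw [uIcc_of_le hab] at ht
        exact abs_of_nonpos (hnp t ht)
    rw [h1, intervalIntegral.integral_neg, hftc]
    have : pertPrim c₀ b - pertPrim c₀ a ≤ 0 := by
      rw [← hftc]
      have h0 : 0 ≤ ∫ t in a..b, -pert c₀ t :=
        intervalIntegral.integral_nonneg hab (fun t ht => neg_nonneg.mpr (hnp t ht))
      rw [intervalIntegral.integral_neg] at h0
      linarith
    rw [abs_of_nonpos this]
  · -- θ ≥ 0
    have hnn : ∀ t ∈ Icc a b, 0 ≤ pert c₀ t := fun t ht => by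
      rw [hval t ht]; exact div_nonneg (by linarith) (hsign t ht).le
    have h1 : ∫ t in a..b, |pert c₀ t| = ∫ t in a..b, pert c₀ t :=
      integral_congr fun t ht => by
        rw [uIcc_of_le hab] at ht
        exact abs_of_nonneg (hnn t ht)
    rw [h1, hftc]
    have : 0 ≤ pertPrim c₀ b - pertPrim c₀ a := by
      rw [← hftc]; exact intervalIntegral.integral_nonneg hab hnn
    rw [abs_of_nonneg this]

/-- Pointwise small densities have small `L¹`-norm on subintervals of `[0, 1]`. [folklore] -/
theorem integral_abs_le_of_abs_le {g : ℝ → ℝ} {a b K : ℝ} (hab : a ≤ b) (hba : b - a ≤ 1) (hK : 0 ≤ K)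
    (h : ∀ t ∈ Icc a b, |g t| ≤ K) : (∫ t in a..b, |g t|) ≤ K := by
  have h1 : ‖∫ t in a..b, |g t|‖ ≤ K * |b - a| := by
    refine intervalIntegral.norm_integral_le_of_norm_le_const fun t ht => ?_
    rw [uIoc_of_le hab] at ht
    rw [Real.norm_eq_abs, abs_abs]
    exact h t ⟨ht.1.le, ht.2⟩
  rw [abs_of_nonneg (by linarith : 0 ≤ b - a)] at h1
  calc (∫ t in a..b, |g t|) ≤ ‖∫ t in a..b, |g t|‖ := Real.le_norm_self _
    _ ≤ K * (b - a) := h1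
    _ ≤ K * 1 := mul_le_mul_of_nonneg_left hba hK
    _ = K := mul_one K

/-- The clamp onto `[a, b]`. [folklore] -/
def clamp (a b t : ℝ) : ℝ := max a (min t b)

/-- The clamp is the identity on `[a, b]`. [folklore] -/
theorem clamp_of_mem {a b t : ℝ} (ht : t ∈ Icc a b) : clamp a b t = t := by
  unfold clamp; rw [min_eq_left ht.2, max_eq_right ht.1]

/-- The clamp takes values in `[a, b]`. [folklore] -/
theorem clamp_mem {a b : ℝ} (hab : a ≤ b) (t : ℝ) : clamp a b t ∈ Icc a b :=
  ⟨le_max_left _ _, max_le hab (min_le_right _ _)⟩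

/-- The clamp is continuous. [folklore] -/
theorem continuous_clamp (a b : ℝ) : Continuous (clamp a b) :=
  continuous_const.max (continuous_id.min continuous_const)

/-- A function continuous on `[a, b]` composed with the clamp is continuous. [folklore] -/
theorem continuous_comp_clamp {a b : ℝ} (hab : a ≤ b) {θ : ℝ → ℝ} (hθ : ContinuousOn θ (Icc a b)) :
    Continuous fun t => θ (clamp a b t) :=
  hθ.comp_continuous (continuous_clamp a b) (clamp_mem hab)

/-- `e^{-s} < 1/2` for `s ≥ 1`. [folklore] -/
theorem exp_neg_lt_half {s : ℝ} (hs : 1 ≤ s) : Real.exp (-s) < 1 / 2 := by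
  have h1 : Real.exp (-s) ≤ Real.exp (-1) := Real.exp_le_exp.mpr (by linarith)
  have h2 : Real.exp (-1) < 1 / 2 := by
    have := Real.exp_one_gt_d9
    rw [Real.exp_neg, inv_eq_one_div, div_lt_div_iff₀ (Real.exp_pos 1) (by norm_num : (0:ℝ) < 2)]
    linarith
  exact h1.trans_lt h2

end EdgeAnalysis

/-! ## 10. The five edges -/

section Edges

open L5

variable {ε : ℝ} (hε0 : 0 < ε) (hε : ε < 1 / 2)

/-! ### Edge 2: the diagonal from `V₂ = (ε-ε², ε)` to `V₃ = (1-ε, 1-ε+ε²)` -/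

/-- Substitution matrix of edge 2: `u ↦ u + v`, `omu ↦ omu + omv`, identity otherwise. [folklore] -/
def m2 : L5 → L5 → ℝ
  | u, u => 1
  | u, v => 1
  | v, v => 1
  | omu, omu => 1
  | omu, omv => 1
  | omv, omv => 1
  | vmu, vmu => 1
  | _, _ => 0

/-- Parameter interval of edge 2. [folklore] -/
def a2 (ε : ℝ) : ℝ := ε - ε ^ 2
/-- Parameter interval of edge 2. [folklore] -/
def b2 (ε : ℝ) : ℝ := 1 - ε

/-- Adapted densities of edge 2: exact `dt/t` on `u`, `dt/(t-1)` on `omu`, the (clamped) perturbations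
on `v`, `omv`, and `0` on `vmu`. [folklore] -/
def g2 (ε : ℝ) : L5 → ℝ → ℝ
  | u, t => 1 / t
  | omu, t => 1 / (t - 1)
  | v, t => pert (ε ^ 2) (clamp (a2 ε) (b2 ε) t)
  | omv, t => -pert (-ε ^ 2) (1 - clamp (a2 ε) (b2 ε) t)
  | vmu, _ => 0

/-- Base point of the line of edge 2. [folklore] -/
def P2 (ε : ℝ) : ℝ × ℝ := (0, ε ^ 2)
/-- Direction of the line of edge 2. [folklore] -/
def D2 : ℝ × ℝ := (1, 1)

/-- Edge 2 starts at `V₂`. [folklore] -/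
theorem P2_a2 (ε : ℝ) : P2 ε + a2 ε • D2 = V2 ε := by
  ext <;> simp [P2, a2, D2, V2]

/-- Edge 2 ends at `V₃`. [folklore] -/
theorem P2_b2 (ε : ℝ) : P2 ε + b2 ε • D2 = V3 ε := by
  ext
  · simp [P2, b2, D2, V3]
  · simp [P2, b2, D2, V3]; ring

/-- `a₂ ≤ b₂`. [folklore] -/
theorem a2_le_b2 (ε : ℝ) : a2 ε ≤ b2 ε := by unfold a2 b2; nlinarith [sq_nonneg (1 - ε)]

include hε0 hε

/-- `0 < a₂`. [folklore] -/
theorem a2_pos : 0 < a2 ε := by unfold a2; nlinarith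

/-- **Edge 2 satisfies the edge hypotheses** with `η = 6ε`. [cite: Drinfeld1991, §2] -/
theorem edgeHyp2 : EdgeHyp m2 (g2 ε) u omu (6 * ε) (a2 ε) (b2 ε) (P2 ε) D2 := by
  have ha0 : 0 < a2 ε := a2_pos hε0 hε
  have hab : a2 ε ≤ b2 ε := a2_le_b2 ε
  have hb1 : b2 ε < 1 := by unfold b2; linarith
  have hε2 : ε ^ 2 < ε := by nlinarith
  refine
    { hxy := by decide
      hη := by linarith
      hgx := fun t _ => rfl
      hgy := fun t _ => rfl
      hcont := ?_
      ha0 := ha0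
      ha := by unfold a2; nlinarith
      hb1 := by unfold b2; linarith
      hb := hb1
      hsmall := ?_
      hlin := ?_
      hpa := by rw [P2_a2]; exact V2_mem hε0 hε
      hpb := by rw [P2_b2]; exact V3_mem hε0 hε }
  · -- continuity on (0,1)
    intro c
    cases c with
    | u =>
      show ContinuousOn (fun t : ℝ => 1 / t) (Ioo 0 1)
      exact continuousOn_const.div continuousOn_id fun t ht => ht.1.ne'
    | omu =>
      show ContinuousOn (fun t : ℝ => 1 / (t - 1)) (Ioo 0 1)
      exact continuousOn_const.div (continuousOn_id.sub continuousOn_const)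
        fun t ht => by have := ht.2; intro h; linarith
    | v =>
      show ContinuousOn (fun t : ℝ => pert (ε ^ 2) (clamp (a2 ε) (b2 ε) t)) (Ioo 0 1)
      refine (continuous_comp_clamp hab (θ := pert (ε ^ 2)) (continuousOn_pert fun t ht => ?_)).continuousOn
      have : 0 < t := ha0.trans_le ht.1
      constructor <;> positivity
    | omv =>
      show ContinuousOn (fun t : ℝ => -pert (-ε ^ 2) (1 - clamp (a2 ε) (b2 ε) t)) (Ioo 0 1)
      have hθ : ContinuousOn (fun t : ℝ => -pert (-ε ^ 2) (1 - t)) (Icc (a2 ε) (b2 ε)) := by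
        have hsub : ContinuousOn (fun t : ℝ => 1 - t) (Icc (a2 ε) (b2 ε)) :=
          (continuous_const.sub continuous_id).continuousOn
        refine ((continuousOn_pert (c₀ := -ε ^ 2) (S := (fun t : ℝ => 1 - t) '' Icc (a2 ε) (b2 ε))
          ?_).comp hsub (mapsTo_image _ _)).neg
        rintro _ ⟨t, ht, rfl⟩
        simp only [a2, b2] at ht
        exact ⟨by intro h; linarith [ht.2], by intro h; nlinarith [ht.2]⟩
      exact (continuous_comp_clamp hab hθ).continuousOn
    | vmu => exact continuousOn_const
  · -- neutral letters are small in L¹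
    intro c hcu hcomu
    cases c with
    | u => exact absurd rfl hcu
    | omu => exact absurd rfl hcomu
    | vmu => simp only [g2, abs_zero, intervalIntegral.integral_zero]; linarith
    | v =>
      have hcongr : ∫ t in a2 ε..b2 ε, |g2 ε v t| = ∫ t in a2 ε..b2 ε, |pert (ε ^ 2) t| :=
        integral_congr fun t ht => by
          rw [uIcc_of_le hab] at ht
          simp only [g2, clamp_of_mem ht]
      rw [hcongr, integral_abs_pert hab fun t ht => ?_]
      · have hval : pertPrim (ε ^ 2) (b2 ε) - pertPrim (ε ^ 2) (a2 ε) = Real.log (1 - (ε - ε ^ 2)) := by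
          unfold pertPrim a2 b2
          have h1 : ε - ε ^ 2 + ε ^ 2 = ε := by ring
          have h2 : ε - ε ^ 2 = ε * (1 - ε) := by ring
          rw [h1, h2, Real.log_mul hε0.ne' (by linarith), show 1 - ε + ε ^ 2 = 1 - ε * (1 - ε) by ring]
          ring
        rw [hval]
        have := abs_log_one_sub_le (u := ε - ε ^ 2) (by nlinarith) (by nlinarith)
        nlinarith
      · have : 0 < t := ha0.trans_le ht.1
        positivity
    | omv =>
      have hcongr : ∫ t in a2 ε..b2 ε, |g2 ε omv t| = ∫ t in a2 ε..b2 ε, |pert (-ε ^ 2) (1 - t)| :=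
        integral_congr fun t ht => by
          rw [uIcc_of_le hab] at ht
          simp only [g2, clamp_of_mem ht, abs_neg]
      rw [hcongr, intervalIntegral.integral_comp_sub_left (fun t => |pert (-ε ^ 2) t|) 1]
      have hab' : 1 - b2 ε ≤ 1 - a2 ε := by linarith
      rw [integral_abs_pert hab' fun t ht => ?_]
      · have hval : pertPrim (-ε ^ 2) (1 - a2 ε) - pertPrim (-ε ^ 2) (1 - b2 ε) =
            -Real.log (1 - (ε - ε ^ 2)) := by
          unfold pertPrim a2 b2
          have h2 : 1 - (1 - ε) + -ε ^ 2 = ε * (1 - ε) := by ring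
          rw [h2, Real.log_mul hε0.ne' (by linarith), show 1 - (ε - ε ^ 2) + -ε ^ 2 = 1 - ε by ring,
            show 1 - (1 - ε) = ε by ring, show 1 - (ε - ε ^ 2) = 1 - ε * (1 - ε) by ring]
          ring_nf
        rw [hval, abs_neg]
        have := abs_log_one_sub_le (u := ε - ε ^ 2) (by nlinarith) (by nlinarith)
        nlinarith
      · simp only [a2, b2] at ht
        have h1 : ε ≤ t := by linarith [ht.1]
        have h2 : 0 < t + -ε ^ 2 := by nlinarith
        have h3 : 0 < t := by linarith
        positivity
  · -- the decomposition of the line densities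
    intro ℓ t ht
    rw [uIcc_of_le hab] at ht
    have hcl : clamp (a2 ε) (b2 ε) t = t := clamp_of_mem ht
    simp only [a2, b2] at ht
    have h0 : t ≠ 0 := by intro h; rw [h] at ht; linarith [ht.1]
    have h1 : t - 1 ≠ 0 := by intro h; linarith [ht.2]
    have h2 : t + ε ^ 2 ≠ 0 := by intro h; nlinarith [ht.1]
    have h3 : 1 - t ≠ 0 := by intro h; linarith [ht.2]
    have h4 : 1 - t + -ε ^ 2 ≠ 0 := by intro h; nlinarith [ht.2]
    have h5 : ε ^ 2 + t ≠ 0 := by intro h; nlinarith [ht.1]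
    have h6 : 1 - (ε ^ 2 + t) ≠ 0 := by intro h; nlinarith [ht.2]
    cases ℓ <;> simp only [lineDens, L5.slope, L5.val, P2, D2, L5.sum_univ, m2, g2, hcl, pert,
      Prod.smul_mk, Prod.mk_add_mk, smul_eq_mul, mul_one, mul_zero, zero_add, add_zero, one_mul, zero_mul]
    case omu => field_simp; ring
    case v => field_simp; ring
    case omv => field_simp; ring
    case vmu => simp

end Edges

section Edges1345

open L5

variable {ε : ℝ} (hε0 : 0 < ε) (hε : ε < 1 / 2)

/-- The identity substitution matrix. [folklore] -/
def idMat : L5 → L5 → ℝ := fun c f => if c = f then 1 else 0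

/-- `Σ_c δ_{c,ℓ} g_c = g_ℓ`. [folklore] -/
theorem sum_idMat_mul (g : L5 → ℝ) (ℓ : L5) : ∑ c, idMat c ℓ * g c = g ℓ := by
  simp [idMat, ite_mul, Finset.sum_ite_eq']

/-- The value of `∫ |θ(-ε², t)| dt` over `[ε, 1 - ε²]` is at most `6ε`. [folklore] -/
theorem integral_abs_pert_neg_sq_le (hε0 : 0 < ε) (hε : ε < 1 / 2) :
    (∫ t in ε..(1 - ε ^ 2), |pert (-ε ^ 2) t|) ≤ 6 * ε := by
  have hε2 : ε ^ 2 < ε := by nlinarith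
  have hab : ε ≤ 1 - ε ^ 2 := by nlinarith
  rw [integral_abs_pert hab fun t ht => ?_]
  · have hval : pertPrim (-ε ^ 2) (1 - ε ^ 2) - pertPrim (-ε ^ 2) ε =
        Real.log (1 - 2 * ε ^ 2) - Real.log (1 - ε ^ 2) - Real.log (1 - ε) := by
      unfold pertPrim
      rw [show ε + -ε ^ 2 = ε * (1 - ε) by ring, Real.log_mul hε0.ne' (by linarith),
        show 1 - ε ^ 2 + -ε ^ 2 = 1 - 2 * ε ^ 2 by ring]
      ring
    rw [hval]
    have h1 := abs_log_one_sub_le (u := 2 * ε ^ 2) (by positivity) (by nlinarith)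
    have h2 := abs_log_one_sub_le (u := ε ^ 2) (by positivity) (by nlinarith)
    have h3 := abs_log_one_sub_le (u := ε) hε0.le hε.le
    calc |Real.log (1 - 2 * ε ^ 2) - Real.log (1 - ε ^ 2) - Real.log (1 - ε)|
        ≤ |Real.log (1 - 2 * ε ^ 2) - Real.log (1 - ε ^ 2)| + |Real.log (1 - ε)| := abs_sub _ _
      _ ≤ |Real.log (1 - 2 * ε ^ 2)| + |Real.log (1 - ε ^ 2)| + |Real.log (1 - ε)| :=
          add_le_add (abs_sub _ _) le_rfl
      _ ≤ 6 * ε := by nlinarith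
  · have h1 : ε ≤ t := ht.1
    have h2 : 0 < t + -ε ^ 2 := by nlinarith
    have h3 : 0 < t := by linarith
    positivity

/-! ### Edge 1: from `V₁ = (ε², ε)` to `V₂ = (ε-ε², ε)` along `v = ε` -/

/-- Base point of edge 1. [folklore] -/
def P1e (ε : ℝ) : ℝ × ℝ := (0, ε)
/-- Direction of edge 1. [folklore] -/
def D1e (ε : ℝ) : ℝ × ℝ := (ε, 0)

/-- Edge 1 starts at `V₁`. [folklore] -/
theorem P1_a1 (ε : ℝ) : P1e ε + ε • D1e ε = V1 ε := by
  ext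
  · simp [P1e, D1e, V1]; ring
  · simp [P1e, D1e, V1]

/-- Edge 1 ends at `V₂`. [folklore] -/
theorem P1_b1 (ε : ℝ) : P1e ε + (1 - ε) • D1e ε = V2 ε := by
  ext
  · simp [P1e, D1e, V2]; ring
  · simp [P1e, D1e, V2]

include hε0 hε

/-- The open unit parameter interval of edge 1 lies in the cell. [folklore] -/
theorem P1_mem {τ : ℝ} (hτ : τ ∈ Ioo (0 : ℝ) 1) : P1e ε + τ • D1e ε ∈ cellU := by
  simp only [P1e, D1e, cellU, Prod.smul_mk, Prod.mk_add_mk, smul_eq_mul, mul_zero, add_zero, zero_add,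
    mem_setOf_eq]
  refine ⟨by nlinarith [hτ.1], by nlinarith [hτ.2], by linarith⟩

/-- **Edge 1 satisfies the edge hypotheses** (`m = id`, densities = the line densities, `η = 6ε`).
[cite: Drinfeld1991, §2] -/
theorem edgeHyp1 : EdgeHyp idMat (lineDens (P1e ε) (D1e ε)) u vmu (6 * ε) ε (1 - ε) (P1e ε) (D1e ε) := by
  have hab : ε ≤ 1 - ε := by linarith
  refine
    { hxy := by decide
      hη := by linarith
      hgx := fun t ht => ?_
      hgy := fun t ht => ?_
      hcont := fun c => (continuousOn_lineDens _ _ c).mono fun τ hτ =>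
        mem_lineDom_of_mem_cellU (P1_mem hε0 hε hτ)
      ha0 := hε0
      ha := hε
      hb1 := by linarith
      hb := by linarith
      hsmall := ?_
      hlin := fun ℓ t _ => (sum_idMat_mul (fun c => lineDens (P1e ε) (D1e ε) c t) ℓ).symm
      hpa := by rw [P1_a1]; exact V1_mem hε0 hε
      hpb := by rw [P1_b1]; exact V2_mem hε0 hε }
  · have h0 : t ≠ 0 := ht.1.ne'
    simp only [lineDens, L5.slope, L5.val, P1e, D1e, Prod.smul_mk, Prod.mk_add_mk, smul_eq_mul, mul_zero,
      add_zero, zero_add]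
    field_simp
  · have h1 : 1 - t ≠ 0 := by intro h; linarith [ht.2]
    have h1' : t - 1 ≠ 0 := by intro h; linarith [ht.2]
    simp only [lineDens, L5.slope, L5.val, P1e, D1e, Prod.smul_mk, Prod.mk_add_mk, smul_eq_mul, mul_zero,
      add_zero, zero_add]
    field_simp
    ring
  · intro c hcu hcvmu
    have hb1 : (1 - ε) - ε ≤ 1 := by linarith
    refine integral_abs_le_of_abs_le hab hb1 (by linarith) fun t ht => ?_
    have ht1 : t ≤ 1 := by linarith [ht.2]
    have ht0 : 0 ≤ t := by linarith [ht.1]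
    cases c with
    | u => exact absurd rfl hcu
    | vmu => exact absurd rfl hcvmu
    | v => simp [lineDens, L5.slope, D1e]; linarith
    | omv => simp [lineDens, L5.slope, D1e]; linarith
    | omu =>
      simp only [lineDens, L5.slope, L5.val, P1e, D1e, Prod.smul_mk, Prod.mk_add_mk, smul_eq_mul, mul_zero,
        add_zero, zero_add]
      have hden : 0 < 1 - t * ε := by nlinarith
      have htε : t * ε ≤ ε := mul_le_of_le_one_left hε0.le ht1
      rw [abs_div, abs_neg, abs_of_pos hε0, abs_of_pos hden, div_le_iff₀ hden]
      nlinarith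

/-! ### Edge 3: from `V₃ = (1-ε, 1-ε+ε²)` to `V₄ = (1-ε, 1-ε²)` along `u = 1 - ε` -/

/-- Base point of edge 3. [folklore] -/
def P3e (ε : ℝ) : ℝ × ℝ := (1 - ε, 1 - ε)
/-- Direction of edge 3. [folklore] -/
def D3e (ε : ℝ) : ℝ × ℝ := (0, ε)

omit hε0 hε in
/-- Edge 3 starts at `V₃`. [folklore] -/
theorem P3_a3 (ε : ℝ) : P3e ε + ε • D3e ε = V3 ε := by
  ext
  · simp [P3e, D3e, V3]
  · simp [P3e, D3e, V3]; ring

omit hε0 hε in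
/-- Edge 3 ends at `V₄`. [folklore] -/
theorem P3_b3 (ε : ℝ) : P3e ε + (1 - ε) • D3e ε = V4 ε := by
  ext
  · simp [P3e, D3e, V4]
  · simp [P3e, D3e, V4]; ring

/-- The open unit parameter interval of edge 3 lies in the cell. [folklore] -/
theorem P3_mem {τ : ℝ} (hτ : τ ∈ Ioo (0 : ℝ) 1) : P3e ε + τ • D3e ε ∈ cellU := by
  simp only [P3e, D3e, cellU, Prod.smul_mk, Prod.mk_add_mk, smul_eq_mul, mul_zero, add_zero,
    mem_setOf_eq]
  refine ⟨by linarith, by nlinarith [hτ.1], by nlinarith [hτ.2]⟩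

/-- **Edge 3 satisfies the edge hypotheses** (`m = id`, `η = 6ε`). [cite: Drinfeld1991, §2] -/
theorem edgeHyp3 : EdgeHyp idMat (lineDens (P3e ε) (D3e ε)) vmu omv (6 * ε) ε (1 - ε) (P3e ε) (D3e ε) := by
  have hab : ε ≤ 1 - ε := by linarith
  refine
    { hxy := by decide
      hη := by linarith
      hgx := fun t ht => ?_
      hgy := fun t ht => ?_
      hcont := fun c => (continuousOn_lineDens _ _ c).mono fun τ hτ =>
        mem_lineDom_of_mem_cellU (P3_mem hε0 hε hτ)
      ha0 := hε0
      ha := hε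
      hb1 := by linarith
      hb := by linarith
      hsmall := ?_
      hlin := fun ℓ t _ => (sum_idMat_mul (fun c => lineDens (P3e ε) (D3e ε) c t) ℓ).symm
      hpa := by rw [P3_a3]; exact V3_mem hε0 hε
      hpb := by rw [P3_b3]; exact V4_mem hε0 hε }
  · have h0 : t ≠ 0 := ht.1.ne'
    have h2 : 1 - ε + t * ε - (1 - ε) ≠ 0 := by nlinarith [mul_pos ht.1 hε0]
    simp only [lineDens, L5.slope, L5.val, P3e, D3e, Prod.smul_mk, Prod.mk_add_mk, smul_eq_mul, mul_zero,
      add_zero, sub_zero]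
    rw [div_eq_div_iff h2 h0]
    ring
  · have h1' : t - 1 ≠ 0 := by intro h; linarith [ht.2]
    have h2 : 1 - (1 - ε + t * ε) ≠ 0 := by
      have := mul_pos hε0 (by linarith [ht.2] : (0:ℝ) < 1 - t); nlinarith
    simp only [lineDens, L5.slope, L5.val, P3e, D3e, Prod.smul_mk, Prod.mk_add_mk, smul_eq_mul, mul_zero,
      add_zero]
    rw [div_eq_div_iff h2 h1']
    ring
  · intro c hcvmu hcomv
    have hb1 : (1 - ε) - ε ≤ 1 := by linarith
    refine integral_abs_le_of_abs_le hab hb1 (by linarith) fun t ht => ?_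
    have ht1 : t ≤ 1 := by linarith [ht.2]
    have ht0 : 0 ≤ t := by linarith [ht.1]
    cases c with
    | vmu => exact absurd rfl hcvmu
    | omv => exact absurd rfl hcomv
    | u => simp [lineDens, L5.slope, D3e]; linarith
    | omu => simp [lineDens, L5.slope, D3e]; linarith
    | v =>
      simp only [lineDens, L5.slope, L5.val, P3e, D3e, Prod.smul_mk, Prod.mk_add_mk, smul_eq_mul, mul_zero,
        add_zero]
      have hden : 0 < 1 - ε + t * ε := by nlinarith
      have htε : 0 ≤ t * ε := mul_nonneg ht0 hε0.le
      rw [abs_div, abs_of_pos hε0, abs_of_pos hden, div_le_iff₀ hden]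
      nlinarith

/-! ### Edge 4: from `V₅ = (ε², 1-ε²)` to `V₄ = (1-ε, 1-ε²)` along `v = 1 - ε²` -/

/-- Substitution matrix of edge 4: `omu ↦ omu + vmu`, identity otherwise. [folklore] -/
def m4 : L5 → L5 → ℝ
  | u, u => 1
  | v, v => 1
  | omu, omu => 1
  | omu, vmu => 1
  | omv, omv => 1
  | vmu, vmu => 1
  | _, _ => 0

/-- Adapted densities of edge 4. [folklore] -/
def g4 (ε : ℝ) : L5 → ℝ → ℝ
  | u, t => 1 / t
  | omu, t => 1 / (t - 1)
  | vmu, t => -pert (-ε ^ 2) (1 - clamp (ε ^ 2) (1 - ε) t)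
  | v, _ => 0
  | omv, _ => 0

/-- Base point of edge 4. [folklore] -/
def P4e (ε : ℝ) : ℝ × ℝ := (0, 1 - ε ^ 2)
/-- Direction of edge 4. [folklore] -/
def D4e : ℝ × ℝ := (1, 0)

omit hε0 hε in
/-- Edge 4 starts at `V₅`. [folklore] -/
theorem P4_a4 (ε : ℝ) : P4e ε + (ε ^ 2) • D4e = V5 ε := by
  ext <;> simp [P4e, D4e, V5]

omit hε0 hε in
/-- Edge 4 ends at `V₄`. [folklore] -/
theorem P4_b4 (ε : ℝ) : P4e ε + (1 - ε) • D4e = V4 ε := by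
  ext <;> simp [P4e, D4e, V4]

/-- **Edge 4 satisfies the edge hypotheses** with `η = 6ε`. [cite: Drinfeld1991, §2] -/
theorem edgeHyp4 : EdgeHyp m4 (g4 ε) u omu (6 * ε) (ε ^ 2) (1 - ε) (P4e ε) D4e := by
  have hε2 : ε ^ 2 < ε := by nlinarith
  have ha0 : 0 < ε ^ 2 := by positivity
  have hab : ε ^ 2 ≤ 1 - ε := by nlinarith
  refine
    { hxy := by decide
      hη := by linarith
      hgx := fun t _ => rfl
      hgy := fun t _ => rfl
      hcont := ?_
      ha0 := ha0
      ha := by nlinarith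
      hb1 := by linarith
      hb := by linarith
      hsmall := ?_
      hlin := ?_
      hpa := by rw [P4_a4]; exact V5_mem hε0 hε
      hpb := by rw [P4_b4]; exact V4_mem hε0 hε }
  · intro c
    cases c with
    | u =>
      show ContinuousOn (fun t : ℝ => 1 / t) (Ioo 0 1)
      exact continuousOn_const.div continuousOn_id fun t ht => ht.1.ne'
    | omu =>
      show ContinuousOn (fun t : ℝ => 1 / (t - 1)) (Ioo 0 1)
      exact continuousOn_const.div (continuousOn_id.sub continuousOn_const)
        fun t ht => by have := ht.2; intro h; linarith
    | vmu =>
      show ContinuousOn (fun t : ℝ => -pert (-ε ^ 2) (1 - clamp (ε ^ 2) (1 - ε) t)) (Ioo 0 1)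
      have hθ : ContinuousOn (fun t : ℝ => -pert (-ε ^ 2) (1 - t)) (Icc (ε ^ 2) (1 - ε)) := by
        have hsub : ContinuousOn (fun t : ℝ => 1 - t) (Icc (ε ^ 2) (1 - ε)) :=
          (continuous_const.sub continuous_id).continuousOn
        refine ((continuousOn_pert (c₀ := -ε ^ 2) (S := (fun t : ℝ => 1 - t) '' Icc (ε ^ 2) (1 - ε))
          ?_).comp hsub (mapsTo_image _ _)).neg
        rintro _ ⟨t, ht, rfl⟩
        exact ⟨by intro h; linarith [ht.2], by intro h; nlinarith [ht.2]⟩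
      exact (continuous_comp_clamp hab hθ).continuousOn
    | v => exact continuousOn_const
    | omv => exact continuousOn_const
  · intro c hcu hcomu
    cases c with
    | u => exact absurd rfl hcu
    | omu => exact absurd rfl hcomu
    | v => simp only [g4, abs_zero, intervalIntegral.integral_zero]; linarith
    | omv => simp only [g4, abs_zero, intervalIntegral.integral_zero]; linarith
    | vmu =>
      have hcongr : ∫ t in ε ^ 2..1 - ε, |g4 ε vmu t| = ∫ t in ε ^ 2..1 - ε, |pert (-ε ^ 2) (1 - t)| :=
        integral_congr fun t ht => by
          rw [uIcc_of_le hab] at ht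
          simp only [g4, clamp_of_mem ht, abs_neg]
      rw [hcongr, intervalIntegral.integral_comp_sub_left (fun t => |pert (-ε ^ 2) t|) 1,
        show 1 - (1 - ε) = ε by ring]
      exact integral_abs_pert_neg_sq_le hε0 hε
  · intro ℓ t ht
    rw [uIcc_of_le hab] at ht
    have hcl : clamp (ε ^ 2) (1 - ε) t = t := clamp_of_mem ht
    have h0 : t ≠ 0 := by intro h; rw [h] at ht; linarith [ht.1]
    have h1 : t - 1 ≠ 0 := by intro h; linarith [ht.2]
    have h3 : 1 - t ≠ 0 := by intro h; linarith [ht.2]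
    have h4 : 1 - t + -ε ^ 2 ≠ 0 := by intro h; nlinarith [ht.2]
    have h6 : 1 - ε ^ 2 - t ≠ 0 := by intro h; nlinarith [ht.2]
    cases ℓ <;> simp only [lineDens, L5.slope, L5.val, P4e, D4e, L5.sum_univ, m4, g4, hcl, pert,
      Prod.smul_mk, Prod.mk_add_mk, smul_eq_mul, mul_one, mul_zero, zero_add, add_zero, one_mul, zero_mul]
    all_goals (field_simp; ring)

/-! ### Edge 5: from `V₁ = (ε², ε)` to `V₅ = (ε², 1-ε²)` along `u = ε²` -/

/-- Substitution matrix of edge 5: `v ↦ v + vmu`, identity otherwise. [folklore] -/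
def m5 : L5 → L5 → ℝ
  | u, u => 1
  | v, v => 1
  | v, vmu => 1
  | omu, omu => 1
  | omv, omv => 1
  | vmu, vmu => 1
  | _, _ => 0

/-- Adapted densities of edge 5. [folklore] -/
def g5 (ε : ℝ) : L5 → ℝ → ℝ
  | v, t => 1 / t
  | omv, t => 1 / (t - 1)
  | vmu, t => pert (-ε ^ 2) (clamp ε (1 - ε ^ 2) t)
  | u, _ => 0
  | omu, _ => 0

/-- Base point of edge 5. [folklore] -/
def P5e (ε : ℝ) : ℝ × ℝ := (ε ^ 2, 0)
/-- Direction of edge 5. [folklore] -/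
def D5e : ℝ × ℝ := (0, 1)

omit hε0 hε in
/-- Edge 5 starts at `V₁`. [folklore] -/
theorem P5_a5 (ε : ℝ) : P5e ε + ε • D5e = V1 ε := by
  ext <;> simp [P5e, D5e, V1]

omit hε0 hε in
/-- Edge 5 ends at `V₅`. [folklore] -/
theorem P5_b5 (ε : ℝ) : P5e ε + (1 - ε ^ 2) • D5e = V5 ε := by
  ext <;> simp [P5e, D5e, V5]

/-- **Edge 5 satisfies the edge hypotheses** with `η = 6ε`. [cite: Drinfeld1991, §2] -/
theorem edgeHyp5 : EdgeHyp m5 (g5 ε) v omv (6 * ε) ε (1 - ε ^ 2) (P5e ε) D5e := by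
  have hε2 : ε ^ 2 < ε := by nlinarith
  have hab : ε ≤ 1 - ε ^ 2 := by nlinarith
  refine
    { hxy := by decide
      hη := by linarith
      hgx := fun t _ => rfl
      hgy := fun t _ => rfl
      hcont := ?_
      ha0 := hε0
      ha := hε
      hb1 := by nlinarith
      hb := by nlinarith
      hsmall := ?_
      hlin := ?_
      hpa := by rw [P5_a5]; exact V1_mem hε0 hε
      hpb := by rw [P5_b5]; exact V5_mem hε0 hε }
  · intro c
    cases c with
    | v =>
      show ContinuousOn (fun t : ℝ => 1 / t) (Ioo 0 1)
      exact continuousOn_const.div continuousOn_id fun t ht => ht.1.ne'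
    | omv =>
      show ContinuousOn (fun t : ℝ => 1 / (t - 1)) (Ioo 0 1)
      exact continuousOn_const.div (continuousOn_id.sub continuousOn_const)
        fun t ht => by have := ht.2; intro h; linarith
    | vmu =>
      show ContinuousOn (fun t : ℝ => pert (-ε ^ 2) (clamp ε (1 - ε ^ 2) t)) (Ioo 0 1)
      refine (continuous_comp_clamp hab (θ := pert (-ε ^ 2)) (continuousOn_pert fun t ht => ?_)).continuousOn
      exact ⟨by intro h; rw [h] at ht; linarith [ht.1], by intro h; nlinarith [ht.1]⟩
    | u => exact continuousOn_const
    | omu => exact continuousOn_const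
  · intro c hcv hcomv
    cases c with
    | v => exact absurd rfl hcv
    | omv => exact absurd rfl hcomv
    | u => simp only [g5, abs_zero, intervalIntegral.integral_zero]; linarith
    | omu => simp only [g5, abs_zero, intervalIntegral.integral_zero]; linarith
    | vmu =>
      have hcongr : ∫ t in ε..1 - ε ^ 2, |g5 ε vmu t| = ∫ t in ε..1 - ε ^ 2, |pert (-ε ^ 2) t| :=
        integral_congr fun t ht => by
          rw [uIcc_of_le hab] at ht
          simp only [g5, clamp_of_mem ht]
      rw [hcongr]
      exact integral_abs_pert_neg_sq_le hε0 hε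
  · intro ℓ t ht
    rw [uIcc_of_le hab] at ht
    have hcl : clamp ε (1 - ε ^ 2) t = t := clamp_of_mem ht
    have h0 : t ≠ 0 := by intro h; rw [h] at ht; linarith [ht.1]
    have h1 : t - 1 ≠ 0 := by intro h; nlinarith [ht.2]
    have h3 : 1 - t ≠ 0 := by intro h; nlinarith [ht.2]
    have h4 : t + -ε ^ 2 ≠ 0 := by intro h; nlinarith [ht.1]
    have h6 : t - ε ^ 2 ≠ 0 := by intro h; nlinarith [ht.1]
    cases ℓ <;> simp only [lineDens, L5.slope, L5.val, P5e, D5e, L5.sum_univ, m5, g5, hcl, pert,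
      Prod.smul_mk, Prod.mk_add_mk, smul_eq_mul, mul_one, mul_zero, zero_add, add_zero, one_mul, zero_mul,
      sub_zero]
    all_goals (field_simp; ring)

end Edges1345

/-! ## 11. Bounds as functions of the scale `s = log(1/ε)` -/

section ScaleBounds

open L5

/-- The scale `ε = e^{-s}`. [folklore] -/
def eps (s : ℝ) : ℝ := Real.exp (-s)

/-- `ε > 0`. [folklore] -/
theorem eps_pos (s : ℝ) : 0 < eps s := Real.exp_pos _

/-- `ε < 1/2` for `s ≥ 1`. [folklore] -/
theorem eps_lt_half {s : ℝ} (hs : 1 ≤ s) : eps s < 1 / 2 := exp_neg_lt_half hs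

/-- `log ε = -s`. [folklore] -/
theorem log_eps (s : ℝ) : Real.log (eps s) = -s := Real.log_exp _

/-- `ε` is negligible. [folklore] -/
theorem negl_eps : Negl eps := negl_exp_neg

/-- Negligible functions are polynomially bounded. [folklore] -/
theorem Negl.polyBd {h : ℝ → ℝ} (hh : Negl h) : PolyBd h := by
  refine ⟨0, 1, ?_⟩
  have h0 : Tendsto (fun s => |h s|) atTop (𝓝 0) := by simpa using hh.tendsto.abs
  filter_upwards [h0.eventually (gt_mem_nhds (show (0:ℝ) < 1 by norm_num))] with s hs
  simpa using hs.le

/-- The explicit negligible bound for `edgeErr` at scale `s`. [folklore] -/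
def Ebd (x y : L5) (N : ℕ) (s : ℝ) : ℝ :=
  ((NCSeries.wordsLE L5 N).card * regBoundBool N * ((N + 1) ^ 2 * 16 ^ N) * 2) *
      ((2 * s + 3) ^ N * eps s) +
    ((NCSeries.wordsLE L5 N).card * regBound x y N * 6) * ((4 * s + 6) ^ N * eps s)

/-- `Ebd` is negligible. [folklore] -/
theorem negl_Ebd (x y : L5) (N : ℕ) : Negl (Ebd x y N) :=
  ((negl_eps.mul_polyBd ((polyBd_affine 2 3).pow N)).const_mul _).add
    ((negl_eps.mul_polyBd ((polyBd_affine 4 6).pow N)).const_mul _)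

/-- **`edgeErr ≤ Ebd`** under the scale hypotheses of an edge. [folklore] -/
theorem edgeErr_le_Ebd {x y : L5} (N : ℕ) {s η a b : ℝ} (hs : 1 ≤ s) (ha0 : 0 < a)
    (ha : a ≤ eps s) (hla : |Real.log a| ≤ 2 * s + 1) (hb : b ≤ 1) (hb' : 1 - b ≤ eps s)
    (hlb : |Real.log (1 - b)| ≤ 2 * s + 1) (hη0 : 0 ≤ η) (hη : η ≤ 6 * eps s) :
    edgeErr x y N η a b ≤ Ebd x y N s := by
  have he : eps s ≤ 1 / 2 := (eps_lt_half hs).le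
  have he0 : 0 < eps s := eps_pos s
  have hRB := regBoundBool_nonneg N
  have hRB' := regBound_nonneg (x := x) (y := y) N
  have hcard : (0 : ℝ) ≤ (NCSeries.wordsLE L5 N).card := Nat.cast_nonneg _
  -- the rate
  have hrate : KZ3.rate N a b ≤ 2 * ((2 * s + 3) ^ N * eps s) := by
    unfold KZ3.rate
    have hp : (0:ℝ) ≤ (2 * s + 3) ^ N := pow_nonneg (by linarith) N
    have h1 : (|Real.log a| + 2) ^ N * a ≤ (2 * s + 3) ^ N * eps s :=
      mul_le_mul (pow_le_pow_left₀ (by positivity) (by linarith) N) ha ha0.le hp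
    have h2 : (|Real.log (1 - b)| + 2) ^ N * (1 - b) ≤ (2 * s + 3) ^ N * eps s :=
      mul_le_mul (pow_le_pow_left₀ (by positivity) (by linarith) N) hb' (by linarith) hp
    linarith
  -- the K-term
  have hK : η * (1 + (|Real.log a| + |Real.log (1 - b)| + η)) ^ N ≤
      6 * eps s * (4 * s + 6) ^ N := by
    refine mul_le_mul hη (pow_le_pow_left₀ (by positivity) (by linarith) N) (by positivity) ?_
    exact mul_nonneg (by norm_num) he0.le
  unfold edgeErr Ebd
  have hr0 : 0 ≤ KZ3.rate N a b := KZ3.rate_nonneg N ha0.le hb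
  nlinarith [mul_nonneg hcard hRB, mul_nonneg hcard hRB',
    mul_le_mul_of_nonneg_left hrate
      (by positivity : (0:ℝ) ≤ (NCSeries.wordsLE L5 N).card * regBoundBool N * ((N + 1) ^ 2 * 16 ^ N)),
    mul_le_mul_of_nonneg_left hK (by positivity : (0:ℝ) ≤ (NCSeries.wordsLE L5 N).card * regBound x y N)]

/-- The polynomial scale at scale `s`: `expScale N (2s+1)`. [folklore] -/
theorem polyBd_expScale (N : ℕ) : PolyBd fun s => expScale N (2 * s + 1) := by
  have h : (fun s : ℝ => expScale N (2 * s + 1)) = fun s => ((N : ℝ) + 1) ^ 2 * (4 * s + 3) ^ N := by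
    funext s; simp only [expScale]; ring
  rw [h]
  exact (polyBd_const _).mul ((polyBd_affine 4 3).pow N)

/-- The explicit negligible bound for the model error of an edge at scale `s`. [folklore] -/
def genericBd (m : L5 → L5 → ℝ) (x y : L5) (N : ℕ) (s : ℝ) : ℝ :=
  NCSeries.pushConst m ^ N * (expScale N (2 * s + 1) ^ 2 *
    ((NCSeries.tn N (embPhi x y : NCSeries L5 ℝ) + Ebd x y N s) * (4 * eps s) + Ebd x y N s))

/-- `genericBd` is negligible. [folklore] -/
theorem negl_genericBd (m : L5 → L5 → ℝ) (x y : L5) (N : ℕ) : Negl (genericBd m x y N) := by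
  have h1 : Negl fun s => (NCSeries.tn N (embPhi x y : NCSeries L5 ℝ) + Ebd x y N s) * (4 * eps s) :=
    (negl_eps.const_mul 4).mul_polyBd ((polyBd_const _).add (negl_Ebd x y N).polyBd)
  exact ((h1.add (negl_Ebd x y N)).mul_polyBd ((polyBd_expScale N).pow 2)).const_mul _

/-- **The model error of an edge is at most `genericBd`** under the scale hypotheses.
[cite: Drinfeld1991, §2] -/
theorem EdgeHyp.tn_sub_model_le_genericBd {m : L5 → L5 → ℝ} {g : L5 → ℝ → ℝ} {x y : L5} {η a b : ℝ}
    {P₀ D : ℝ × ℝ} (H : EdgeHyp m g x y η a b P₀ D) (N : ℕ) {s ℓx₀ ℓy₀ : ℝ} (hs : 1 ≤ s)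
    (ha : a ≤ eps s) (hla : |Real.log a| ≤ 2 * s + 1) (hb' : 1 - b ≤ eps s)
    (hlb : |Real.log (1 - b)| ≤ 2 * s + 1) (hη : η ≤ 6 * eps s)
    (hdx : |Real.log (b / a) - ℓx₀| ≤ 2 * eps s)
    (hdy : |Real.log ((1 - b) / (1 - a)) - ℓy₀| ≤ 2 * eps s)
    (hx₀ : |ℓx₀| ≤ 2 * s) (hy₀ : |ℓy₀| ≤ 2 * s) :
    NCSeries.tn N (NCSeries.push m (transportSeries g a b) - NCSeries.push m (edgeModel x y ℓy₀ ℓx₀)) ≤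
      genericBd m x y N s := by
  have he : eps s ≤ 1 / 2 := (eps_lt_half hs).le
  have he0 : 0 < eps s := eps_pos s
  have hΛx : |Real.log (b / a)| ≤ 2 * s + 1 := by
    have := abs_sub_abs_le_abs_sub (Real.log (b / a)) ℓx₀; linarith
  have hΛy : |Real.log ((1 - b) / (1 - a))| ≤ 2 * s + 1 := by
    have := abs_sub_abs_le_abs_sub (Real.log ((1 - b) / (1 - a))) ℓy₀; linarith
  refine (H.tn_sub_model_le N hΛx hΛy (by linarith) (by linarith)).trans ?_
  unfold genericBd
  have hC : 0 ≤ NCSeries.pushConst m ^ N := pow_nonneg (zero_le_one.trans (NCSeries.one_le_pushConst m)) N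
  refine mul_le_mul_of_nonneg_left ?_ hC
  have hP : 0 ≤ expScale N (2 * s + 1) ^ 2 := by positivity
  refine mul_le_mul_of_nonneg_left ?_ hP
  have hE : edgeErr x y N η a b ≤ Ebd x y N s :=
    edgeErr_le_Ebd N hs H.ha0 ha hla H.hb.le hb' hlb H.hη hη
  have hE0 : 0 ≤ edgeErr x y N η a b := edgeErr_nonneg H.hη N H.ha0.le H.hb.le
  have hΦ : 0 ≤ NCSeries.tn N (embPhi x y : NCSeries L5 ℝ) := NCSeries.tn_nonneg _ _
  have hd : |Real.log (b / a) - ℓx₀| + |Real.log ((1 - b) / (1 - a)) - ℓy₀| ≤ 4 * eps s := by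
    linarith
  have hd0 : 0 ≤ |Real.log (b / a) - ℓx₀| + |Real.log ((1 - b) / (1 - a)) - ℓy₀| := by positivity
  nlinarith [mul_le_mul hE hd hd0 ((hE0.trans hE)), mul_nonneg hΦ hd0, mul_le_mul_of_nonneg_left hd hΦ,
    mul_le_mul_of_nonneg_right hE hd0]

/-- The pushed models are polynomially bounded at scale `s`. [folklore] -/
theorem polyBd_tn_push_edgeModel (N : ℕ) (m : L5 → L5 → ℝ) (x y : L5) (ky kx : ℝ) (hky : |ky| ≤ 2)
    (hkx : |kx| ≤ 2) :
    PolyBd fun s => NCSeries.tn N (NCSeries.push m (edgeModel x y (ky * s) (kx * s))) := by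
  refine ((polyBd_const (NCSeries.pushConst m ^ N)).mul (((polyBd_expScale N).pow 2).mul
    (polyBd_const (NCSeries.tn N (embPhi x y : NCSeries L5 ℝ))))).of_le ?_
  filter_upwards [eventually_ge_atTop 1] with s hs
  rw [abs_of_nonneg (NCSeries.tn_nonneg _ _)]
  refine tn_push_edgeModel_le N m x y ?_ ?_
  · rw [abs_mul, abs_of_nonneg (by linarith : (0:ℝ) ≤ s)]; nlinarith
  · rw [abs_mul, abs_of_nonneg (by linarith : (0:ℝ) ≤ s)]; nlinarith

/-- Pushed exponentials of letters are polynomially bounded at scale `s`. [folklore] -/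
theorem polyBd_tn_push_expLetter (N : ℕ) (m : L5 → L5 → ℝ) (c : L5) (k : ℝ) (hk : |k| ≤ 2) :
    PolyBd fun s => NCSeries.tn N (NCSeries.push m (Shuffle.expLetter c (k * s))) := by
  refine ((polyBd_const (NCSeries.pushConst m ^ N)).mul (polyBd_expScale N)).of_le ?_
  filter_upwards [eventually_ge_atTop 1] with s hs
  rw [abs_of_nonneg (NCSeries.tn_nonneg _ _)]
  refine (NCSeries.tn_push_le N m _).trans (mul_le_mul_of_nonneg_left
    (tn_expLetter_le_expScale N c ?_) (pow_nonneg (zero_le_one.trans (NCSeries.one_le_pushConst m)) N))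
  rw [abs_mul, abs_of_nonneg (by linarith : (0:ℝ) ≤ s)]; nlinarith

/-- Exponentials of letters are polynomially bounded at scale `s`. [folklore] -/
theorem polyBd_tn_expLetter (N : ℕ) (c : L5) (k : ℝ) (hk : |k| ≤ 2) :
    PolyBd fun s => NCSeries.tn N (Shuffle.expLetter c (k * s) : NCSeries L5 ℝ) := by
  refine (polyBd_expScale N).of_le ?_
  filter_upwards [eventually_ge_atTop 1] with s hs
  rw [abs_of_nonneg (NCSeries.tn_nonneg _ _)]
  refine tn_expLetter_le_expScale N c ?_
  rw [abs_mul, abs_of_nonneg (by linarith : (0:ℝ) ≤ s)]; nlinarith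

end ScaleBounds

/-! ## 12. Assembly: the pentagon identity at each truncation level -/

section Assembly

open L5

/-- `|log(1 - u)| ≤ 2 ε` for `0 ≤ u ≤ ε ≤ 1/2`. [folklore] -/
theorem abs_log_one_sub_le_of_le {u e : ℝ} (hu0 : 0 ≤ u) (hue : u ≤ e) (he : e ≤ 1 / 2) :
    |Real.log (1 - u)| ≤ 2 * e :=
  (abs_log_one_sub_le hu0 (hue.trans he)).trans (by linarith)

/-! ### The five edge series and their models at scale `s` -/

/-- Edge 1 transport. [folklore] -/
def Fs1 (s : ℝ) : NCSeries L5 ℝ :=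
  NCSeries.push idMat (transportSeries (lineDens (P1e (eps s)) (D1e (eps s))) (eps s) (1 - eps s))
/-- Edge 1 model. [folklore] -/
def Ms1 (s : ℝ) : NCSeries L5 ℝ := NCSeries.push idMat (edgeModel u vmu ((-1) * s) (1 * s))
/-- Edge 2 transport. [folklore] -/
def Fs2 (s : ℝ) : NCSeries L5 ℝ :=
  NCSeries.push m2 (transportSeries (g2 (eps s)) (a2 (eps s)) (b2 (eps s)))
/-- Edge 2 model. [folklore] -/
def Ms2 (s : ℝ) : NCSeries L5 ℝ := NCSeries.push m2 (edgeModel u omu ((-1) * s) (1 * s))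
/-- Edge 3 transport. [folklore] -/
def Fs3 (s : ℝ) : NCSeries L5 ℝ :=
  NCSeries.push idMat (transportSeries (lineDens (P3e (eps s)) (D3e (eps s))) (eps s) (1 - eps s))
/-- Edge 3 model. [folklore] -/
def Ms3 (s : ℝ) : NCSeries L5 ℝ := NCSeries.push idMat (edgeModel vmu omv ((-1) * s) (1 * s))
/-- Edge 4 transport (from `V₅` to `V₄`). [folklore] -/
def Fs4 (s : ℝ) : NCSeries L5 ℝ :=
  NCSeries.push m4 (transportSeries (g4 (eps s)) (eps s ^ 2) (1 - eps s))
/-- Edge 4 model. [folklore] -/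
def Ms4 (s : ℝ) : NCSeries L5 ℝ := NCSeries.push m4 (edgeModel u omu ((-1) * s) (2 * s))
/-- Edge 5 transport (from `V₁` to `V₅`). [folklore] -/
def Fs5 (s : ℝ) : NCSeries L5 ℝ :=
  NCSeries.push m5 (transportSeries (g5 (eps s)) (eps s) (1 - eps s ^ 2))
/-- Edge 5 model. [folklore] -/
def Ms5 (s : ℝ) : NCSeries L5 ℝ := NCSeries.push m5 (edgeModel v omv ((-2) * s) (1 * s))
/-- The free series evaluating to `N₄⁻¹ = e^{2s t₂₃} e^{s (t₁₂+t₁₃)}`. [folklore] -/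
def ns4 (s : ℝ) : NCSeries L5 ℝ :=
  Shuffle.expLetter omv (2 * s) * NCSeries.push m4 (Shuffle.expLetter omu (1 * s))
/-- The free series evaluating to `N₁ = e^{-2s t₀₁} e^{-s (t₀₂+t₁₂)}`. [folklore] -/
def ns1 (s : ℝ) : NCSeries L5 ℝ :=
  Shuffle.expLetter u ((-2) * s) * NCSeries.push m5 (Shuffle.expLetter v ((-1) * s))
/-- The middle error series. [folklore] -/
def Gmid (s : ℝ) : NCSeries L5 ℝ :=
  Ms3 s * (Ms2 s * Ms1 s) - Fs3 s * (Fs2 s * Fs1 s) + (Fs4 s * Fs5 s - Ms4 s * Ms5 s)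
/-- The total error series. [folklore] -/
def Gtot (s : ℝ) : NCSeries L5 ℝ := ns4 s * Gmid s * ns1 s

variable (N : ℕ)

/-- The right-hand side `Φ(t₁₂,t₂₃) Φ(t₀₁+t₀₂,t₁₃+t₂₃) Φ(t₀₁,t₁₂)` of the pentagon at level `N`.
[cite: Drinfeld1991, (2.13)] -/
def sideX : A4 N :=
  NCSeries.subst₂ N drinfeldAssociator (tt N 1 2) (tt N 2 3) *
    NCSeries.subst₂ N drinfeldAssociator (tt N 0 1 + tt N 0 2) (tt N 1 3 + tt N 2 3) *
      NCSeries.subst₂ N drinfeldAssociator (tt N 0 1) (tt N 1 2)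

/-- The left-hand side `Φ(t₀₁,t₁₂+t₁₃) Φ(t₀₂+t₁₂,t₂₃)` of the pentagon at level `N`.
[cite: Drinfeld1991, (2.13)] -/
def sideY : A4 N :=
  NCSeries.subst₂ N drinfeldAssociator (tt N 0 1) (tt N 1 2 + tt N 1 3) *
    NCSeries.subst₂ N drinfeldAssociator (tt N 0 2 + tt N 1 2) (tt N 2 3)

/-! ### Values of the adapted generators -/

/-- The identity matrix does not change the generators. [folklore] -/
theorem Zm_idMat (c : L5) : Zm N idMat c = tOf N c := by
  simp [Zm, idMat, Finset.sum_ite_eq]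

/-- Edge 2: `Z_x = t₀₁ + t₀₂`. [folklore] -/
theorem Zm_m2_u : Zm N m2 u = tt N 0 1 + tt N 0 2 := by
  simp [Zm, L5.sum_univ, m2, tOf, tt]

/-- Edge 2: `Z_y = t₁₃ + t₂₃`. [folklore] -/
theorem Zm_m2_omu : Zm N m2 omu = tt N 1 3 + tt N 2 3 := by
  simp [Zm, L5.sum_univ, m2, tOf, tt]

/-- Edge 4: `Z_x = t₀₁`. [folklore] -/
theorem Zm_m4_u : Zm N m4 u = tt N 0 1 := by
  simp [Zm, L5.sum_univ, m4, tOf, tt]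

/-- Edge 4: `Z_y = t₁₂ + t₁₃`. [folklore] -/
theorem Zm_m4_omu : Zm N m4 omu = tt N 1 2 + tt N 1 3 := by
  simp [Zm, L5.sum_univ, m4, tOf, tt]; abel

/-- Edge 5: `Z_x = t₀₂ + t₁₂`. [folklore] -/
theorem Zm_m5_v : Zm N m5 v = tt N 0 2 + tt N 1 2 := by
  simp [Zm, L5.sum_univ, m5, tOf, tt]

/-- Edge 5: `Z_y = t₂₃`. [folklore] -/
theorem Zm_m5_omv : Zm N m5 omv = tt N 2 3 := by
  simp [Zm, L5.sum_univ, m5, tOf, tt]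

/-! ### The exact identity `sideX - sideY = ev(G_s)` -/

/-- **The difference of the two sides of the pentagon is the evaluation of the error series**, for
every scale `s ≥ 1`. [cite: Drinfeld1991, §2] -/
theorem sideX_sub_sideY_eq_ev {s : ℝ} (hs : 1 ≤ s) : sideX N - sideY N = ev N (Gtot s) := by
  have hε0 : 0 < eps s := eps_pos s
  have hε : eps s < 1 / 2 := eps_lt_half hs
  have H1 := edgeHyp1 hε0 hε
  have H2 := edgeHyp2 hε0 hε
  have H3 := edgeHyp3 hε0 hε
  have H4 := edgeHyp4 hε0 hε
  have H5 := edgeHyp5 hε0 hε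
  -- the holonomy identity, in terms of the pushed adapted transports
  have hol := holonomy_VV hε0 hε N
  have e1 : segT (V1 (eps s)) (V2 (eps s)) = Fs1 s := by rw [← P1_a1, ← P1_b1]; exact H1.segT_eq
  have e2 : segT (V2 (eps s)) (V3 (eps s)) = Fs2 s := by rw [← P2_a2, ← P2_b2]; exact H2.segT_eq
  have e3 : segT (V3 (eps s)) (V4 (eps s)) = Fs3 s := by rw [← P3_a3, ← P3_b3]; exact H3.segT_eq
  have e4 : segT (V5 (eps s)) (V4 (eps s)) = Fs4 s := by rw [← P4_a4, ← P4_b4]; exact H4.segT_eq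
  have e5 : segT (V1 (eps s)) (V5 (eps s)) = Fs5 s := by rw [← P5_a5, ← P5_b5]; exact H5.segT_eq
  rw [e1, e2, e3, e4, e5] at hol
  -- the models evaluate to the main terms
  have hM1 : ev N (Ms1 s) = EE N ((-s) • tt N 1 2) * NCSeries.subst₂ N drinfeldAssociator (tt N 0 1) (tt N 1 2) *
      EE N (s • tt N 0 1) := by
    rw [Ms1, ev_push_edgeModel, Zm_idMat, Zm_idMat]; simp only [neg_mul, one_mul]; rfl
  have hM2 : ev N (Ms2 s) = EE N ((-s) • (tt N 1 3 + tt N 2 3)) *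
      NCSeries.subst₂ N drinfeldAssociator (tt N 0 1 + tt N 0 2) (tt N 1 3 + tt N 2 3) *
        EE N (s • (tt N 0 1 + tt N 0 2)) := by
    rw [Ms2, ev_push_edgeModel, Zm_m2_u, Zm_m2_omu]; simp only [neg_mul, one_mul]
  have hM3 : ev N (Ms3 s) = EE N ((-s) • tt N 2 3) * NCSeries.subst₂ N drinfeldAssociator (tt N 1 2) (tt N 2 3) *
      EE N (s • tt N 1 2) := by
    rw [Ms3, ev_push_edgeModel, Zm_idMat, Zm_idMat]; simp only [neg_mul, one_mul]; rfl
  have hM4 : ev N (Ms4 s) = EE N ((-s) • (tt N 1 2 + tt N 1 3)) *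
      NCSeries.subst₂ N drinfeldAssociator (tt N 0 1) (tt N 1 2 + tt N 1 3) * EE N ((2 * s) • tt N 0 1) := by
    rw [Ms4, ev_push_edgeModel, Zm_m4_u, Zm_m4_omu]; simp only [neg_mul, one_mul]
  have hM5 : ev N (Ms5 s) = EE N ((-(2 * s)) • tt N 2 3) *
      NCSeries.subst₂ N drinfeldAssociator (tt N 0 2 + tt N 1 2) (tt N 2 3) * EE N (s • (tt N 0 2 + tt N 1 2)) := by
    rw [Ms5, ev_push_edgeModel, Zm_m5_v, Zm_m5_omv]; simp only [neg_mul, one_mul]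
  have key := pentagon_sides_sub_eq (N := N) s drinfeldAssociator (ev N (Ms1 s)) (ev N (Ms2 s)) (ev N (Ms3 s))
    (ev N (Ms4 s)) (ev N (Ms5 s)) hM1 hM2 hM3 hM4 hM5
  -- the normalisations as evaluations
  have hn4 : ev N (ns4 s) = EE N ((2 * s) • tt N 2 3) * EE N (s • (tt N 1 2 + tt N 1 3)) := by
    rw [ns4, ev_mul, ev_push, evalTrunc_expLetter N (Zm N m4) (Zm_nilpotent N m4), Zm_m4_omu,
      show ev N (Shuffle.expLetter omv (2 * s)) = _ from evalTrunc_expLetter N (tOf N) (tOf_nilpotent N) omv (2 * s)]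
    simp only [one_mul]; rfl
  have hn1 : ev N (ns1 s) = EE N ((-(2 * s)) • tt N 0 1) * EE N ((-s) • (tt N 0 2 + tt N 1 2)) := by
    rw [ns1, ev_mul, ev_push, evalTrunc_expLetter N (Zm N m5) (Zm_nilpotent N m5), Zm_m5_v,
      show ev N (Shuffle.expLetter u ((-2) * s)) = _ from evalTrunc_expLetter N (tOf N) (tOf_nilpotent N) u _]
    simp only [neg_mul, one_mul]; rfl
  have hmid : ev N (Gmid s) = ev N (Ms3 s) * (ev N (Ms2 s) * ev N (Ms1 s)) - ev N (Ms4 s) * ev N (Ms5 s) := by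
    simp only [Gmid, ev_add, ev_sub, ev_mul]
    rw [hol]; abel
  rw [sideX, sideY, key, Gtot, ev_mul, ev_mul, hmid, hn4, hn1]

/-! ### The error is negligible -/

/-- Model errors of the five edges are negligible. [cite: Drinfeld1991, §2] -/
theorem negl_edges :
    Negl (fun s => NCSeries.tn N (Fs1 s - Ms1 s)) ∧ Negl (fun s => NCSeries.tn N (Fs2 s - Ms2 s)) ∧
    Negl (fun s => NCSeries.tn N (Fs3 s - Ms3 s)) ∧ Negl (fun s => NCSeries.tn N (Fs4 s - Ms4 s)) ∧
    Negl (fun s => NCSeries.tn N (Fs5 s - Ms5 s)) := by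
  have hev : ∀ (m : L5 → L5 → ℝ) (x y : L5) (F M : ℝ → NCSeries L5 ℝ),
      (∀ s, 1 ≤ s → NCSeries.tn N (F s - M s) ≤ genericBd m x y N s) → Negl fun s => NCSeries.tn N (F s - M s) :=
    fun m x y F M h => (negl_genericBd m x y N).of_le (by
      filter_upwards [eventually_ge_atTop 1] with s hs
      rw [abs_of_nonneg (NCSeries.tn_nonneg _ _)]; exact h s hs)
  -- common scale facts
  have base : ∀ s : ℝ, 1 ≤ s → 0 < eps s ∧ eps s < 1 / 2 ∧ eps s ≤ 1 / 2 ∧ Real.log (eps s) = -s ∧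
      |Real.log (1 - eps s)| ≤ 2 * eps s ∧ |Real.log (1 - eps s ^ 2)| ≤ 2 * eps s ∧
      |Real.log (1 - (eps s - eps s ^ 2))| ≤ 2 * eps s ∧ eps s ^ 2 ≤ eps s := by
    intro s hs
    have h0 := eps_pos s
    have h1 := eps_lt_half hs
    have hsq : eps s ^ 2 ≤ eps s := by nlinarith
    refine ⟨h0, h1, h1.le, log_eps s, abs_log_one_sub_le h0.le h1.le,
      abs_log_one_sub_le_of_le (by positivity) hsq h1.le,
      abs_log_one_sub_le_of_le (by nlinarith) (by nlinarith) h1.le, hsq⟩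
  refine ⟨?_, ?_, ?_, ?_, ?_⟩
  · refine hev idMat u vmu Fs1 Ms1 fun s hs => ?_
    obtain ⟨h0, h1, h1', hlog, hl1, -, -, -⟩ := base s hs
    have H := edgeHyp1 h0 h1
    refine H.tn_sub_model_le_genericBd N hs le_rfl (by rw [hlog, abs_neg, abs_of_nonneg]; all_goals linarith)
      (by simp) (by rw [show 1 - (1 - eps s) = eps s by ring, hlog, abs_neg, abs_of_nonneg]; all_goals linarith)
      (by linarith) ?_ ?_ (by rw [abs_of_nonneg] <;> linarith) (by rw [abs_of_nonpos] <;> linarith)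
    · rw [Real.log_div (by linarith) h0.ne', hlog]
      simpa using hl1
    · rw [show 1 - (1 - eps s) = eps s by ring, Real.log_div h0.ne' (by linarith), hlog]
      rw [show -s - Real.log (1 - eps s) - -1 * s = -Real.log (1 - eps s) by ring, abs_neg]; exact hl1
  · refine hev m2 u omu Fs2 Ms2 fun s hs => ?_
    obtain ⟨h0, h1, h1', hlog, hl1, -, hl3, hsq⟩ := base s hs
    have H := edgeHyp2 h0 h1
    have ha : a2 (eps s) = eps s * (1 - eps s) := by unfold a2; ring
    have hloga : Real.log (a2 (eps s)) = -s + Real.log (1 - eps s) := by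
      rw [ha, Real.log_mul h0.ne' (by linarith), hlog]
    refine H.tn_sub_model_le_genericBd N hs (by unfold a2; nlinarith) ?_
      (by simp [b2]) (by rw [show 1 - b2 (eps s) = eps s by unfold b2; ring, hlog, abs_neg, abs_of_nonneg]; all_goals linarith)
      (by linarith) ?_ ?_ (by rw [abs_of_nonneg] <;> linarith) (by rw [abs_of_nonpos] <;> linarith)
    · rw [hloga]
      have := abs_add_le (-s) (Real.log (1 - eps s))
      rw [abs_neg, abs_of_nonneg (by linarith : (0:ℝ) ≤ s)] at this
      linarith
    · have hq : b2 (eps s) / a2 (eps s) = (eps s)⁻¹ := by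
        have hne : 1 - eps s ≠ 0 := by linarith
        rw [ha, b2]; field_simp
      rw [hq, Real.log_inv, hlog]; simp; positivity
    · rw [show 1 - b2 (eps s) = eps s by unfold b2; ring,
        show 1 - a2 (eps s) = 1 - (eps s - eps s ^ 2) by unfold a2; ring,
        Real.log_div h0.ne' (by nlinarith), hlog,
        show -s - Real.log (1 - (eps s - eps s ^ 2)) - -1 * s = -Real.log (1 - (eps s - eps s ^ 2)) by ring,
        abs_neg]
      exact hl3
  · refine hev idMat vmu omv Fs3 Ms3 fun s hs => ?_
    obtain ⟨h0, h1, h1', hlog, hl1, -, -, -⟩ := base s hs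
    have H := edgeHyp3 h0 h1
    refine H.tn_sub_model_le_genericBd N hs le_rfl (by rw [hlog, abs_neg, abs_of_nonneg]; all_goals linarith)
      (by simp) (by rw [show 1 - (1 - eps s) = eps s by ring, hlog, abs_neg, abs_of_nonneg]; all_goals linarith)
      (by linarith) ?_ ?_ (by rw [abs_of_nonneg] <;> linarith) (by rw [abs_of_nonpos] <;> linarith)
    · rw [Real.log_div (by linarith) h0.ne', hlog]
      simpa using hl1
    · rw [show 1 - (1 - eps s) = eps s by ring, Real.log_div h0.ne' (by linarith), hlog]
      rw [show -s - Real.log (1 - eps s) - -1 * s = -Real.log (1 - eps s) by ring, abs_neg]; exact hl1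
  · refine hev m4 u omu Fs4 Ms4 fun s hs => ?_
    obtain ⟨h0, h1, h1', hlog, hl1, hl2, -, hsq⟩ := base s hs
    have H := edgeHyp4 h0 h1
    have hloga : Real.log (eps s ^ 2) = -(2 * s) := by rw [Real.log_pow, hlog]; ring
    refine H.tn_sub_model_le_genericBd N hs hsq (by rw [hloga, abs_neg, abs_of_nonneg]; all_goals linarith)
      (by simp) (by rw [show 1 - (1 - eps s) = eps s by ring, hlog, abs_neg, abs_of_nonneg]; all_goals linarith)
      (by linarith) ?_ ?_ (by rw [abs_of_nonneg]; linarith) (by rw [abs_of_nonpos] <;> linarith)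
    · rw [Real.log_div (by linarith) (by positivity), hloga]
      rw [show Real.log (1 - eps s) - -(2 * s) - 2 * s = Real.log (1 - eps s) by ring]; exact hl1
    · rw [show 1 - (1 - eps s) = eps s by ring, Real.log_div h0.ne' (by nlinarith), hlog]
      rw [show -s - Real.log (1 - eps s ^ 2) - -1 * s = -Real.log (1 - eps s ^ 2) by ring, abs_neg]; exact hl2
  · refine hev m5 v omv Fs5 Ms5 fun s hs => ?_
    obtain ⟨h0, h1, h1', hlog, hl1, hl2, -, hsq⟩ := base s hs
    have H := edgeHyp5 h0 h1
    have hloga : Real.log (eps s ^ 2) = -(2 * s) := by rw [Real.log_pow, hlog]; ring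
    refine H.tn_sub_model_le_genericBd N hs le_rfl (by rw [hlog, abs_neg, abs_of_nonneg]; all_goals linarith)
      (by rw [show 1 - (1 - eps s ^ 2) = eps s ^ 2 by ring]; exact hsq)
      (by rw [show 1 - (1 - eps s ^ 2) = eps s ^ 2 by ring, hloga, abs_neg, abs_of_nonneg]; all_goals linarith)
      (by linarith) ?_ ?_ (by rw [abs_of_nonneg] <;> linarith) (by rw [abs_of_nonpos] <;> linarith)
    · rw [Real.log_div (by nlinarith) h0.ne', hlog]
      rw [show Real.log (1 - eps s ^ 2) - -s - 1 * s = Real.log (1 - eps s ^ 2) by ring]; exact hl2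
    · rw [show 1 - (1 - eps s ^ 2) = eps s ^ 2 by ring, Real.log_div (by positivity) (by linarith), hloga]
      rw [show -(2 * s) - Real.log (1 - eps s) - -2 * s = -Real.log (1 - eps s) by ring, abs_neg]; exact hl1

/-- The models and normalisations are polynomially bounded. [folklore] -/
theorem polyBd_models :
    PolyBd (fun s => NCSeries.tn N (Ms1 s)) ∧ PolyBd (fun s => NCSeries.tn N (Ms2 s)) ∧
    PolyBd (fun s => NCSeries.tn N (Ms3 s)) ∧ PolyBd (fun s => NCSeries.tn N (Ms4 s)) ∧
    PolyBd (fun s => NCSeries.tn N (Ms5 s)) ∧ PolyBd (fun s => NCSeries.tn N (ns4 s)) ∧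
    PolyBd (fun s => NCSeries.tn N (ns1 s)) := by
  refine ⟨polyBd_tn_push_edgeModel N idMat u vmu (-1) 1 (by norm_num) (by norm_num),
    polyBd_tn_push_edgeModel N m2 u omu (-1) 1 (by norm_num) (by norm_num),
    polyBd_tn_push_edgeModel N idMat vmu omv (-1) 1 (by norm_num) (by norm_num),
    polyBd_tn_push_edgeModel N m4 u omu (-1) 2 (by norm_num) (by norm_num),
    polyBd_tn_push_edgeModel N m5 v omv (-2) 1 (by norm_num) (by norm_num), ?_, ?_⟩
  · refine ((polyBd_tn_expLetter N omv 2 (by norm_num)).mul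
      (polyBd_tn_push_expLetter N m4 omu 1 (by norm_num))).of_le (Eventually.of_forall fun s => ?_)
    rw [abs_of_nonneg (NCSeries.tn_nonneg _ _)]
    exact NCSeries.tn_mul_le _ _ _
  · refine ((polyBd_tn_expLetter N u (-2) (by norm_num)).mul
      (polyBd_tn_push_expLetter N m5 v (-1) (by norm_num))).of_le (Eventually.of_forall fun s => ?_)
    rw [abs_of_nonneg (NCSeries.tn_nonneg _ _)]
    exact NCSeries.tn_mul_le _ _ _

/-- **The total error is negligible.** [cite: Drinfeld1991, §2] -/
theorem negl_tn_Gtot : Negl fun s => NCSeries.tn N (Gtot s) := by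
  obtain ⟨d1, d2, d3, d4, d5⟩ := negl_edges N
  obtain ⟨p1, p2, p3, p4, p5, q4, q1⟩ := polyBd_models N
  -- sizes of the transports themselves
  have f1 : PolyBd fun s => NCSeries.tn N (Fs1 s) := (p1.add d1.polyBd).of_le (Eventually.of_forall fun s => by
    rw [abs_of_nonneg (NCSeries.tn_nonneg _ _)]
    have h := NCSeries.tn_add_le N (Ms1 s) (Fs1 s - Ms1 s); rwa [add_sub_cancel] at h)
  have f2 : PolyBd fun s => NCSeries.tn N (Fs2 s) := (p2.add d2.polyBd).of_le (Eventually.of_forall fun s => by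
    rw [abs_of_nonneg (NCSeries.tn_nonneg _ _)]
    have h := NCSeries.tn_add_le N (Ms2 s) (Fs2 s - Ms2 s); rwa [add_sub_cancel] at h)
  have f5 : PolyBd fun s => NCSeries.tn N (Fs5 s) := (p5.add d5.polyBd).of_le (Eventually.of_forall fun s => by
    rw [abs_of_nonneg (NCSeries.tn_nonneg _ _)]
    have h := NCSeries.tn_add_le N (Ms5 s) (Fs5 s - Ms5 s); rwa [add_sub_cancel] at h)
  -- the middle series
  have hmid : Negl fun s => NCSeries.tn N (Gmid s) := by
    have hbd : Negl fun s =>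
        (NCSeries.tn N (Fs2 s) * NCSeries.tn N (Fs1 s)) * NCSeries.tn N (Fs3 s - Ms3 s) +
        (NCSeries.tn N (Ms3 s) * NCSeries.tn N (Fs1 s)) * NCSeries.tn N (Fs2 s - Ms2 s) +
        (NCSeries.tn N (Ms3 s) * NCSeries.tn N (Ms2 s)) * NCSeries.tn N (Fs1 s - Ms1 s) +
        (NCSeries.tn N (Fs5 s) * NCSeries.tn N (Fs4 s - Ms4 s) +
        NCSeries.tn N (Ms4 s) * NCSeries.tn N (Fs5 s - Ms5 s)) :=
      (((d3.mul_polyBd (f2.mul f1)).add (d2.mul_polyBd (p3.mul f1))).add (d1.mul_polyBd (p3.mul p2))).add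
        ((d4.mul_polyBd f5).add (d5.mul_polyBd p4))
    refine hbd.of_le (Eventually.of_forall fun s => ?_)
    rw [abs_of_nonneg (NCSeries.tn_nonneg _ _)]
    have hsplit : Gmid s = -((Fs3 s - Ms3 s) * (Fs2 s * Fs1 s) + Ms3 s * ((Fs2 s - Ms2 s) * Fs1 s) +
        Ms3 s * (Ms2 s * (Fs1 s - Ms1 s))) + ((Fs4 s - Ms4 s) * Fs5 s + Ms4 s * (Fs5 s - Ms5 s)) := by
      unfold Gmid; noncomm_ring
    rw [hsplit]
    have T := fun (A B : NCSeries L5 ℝ) => NCSeries.tn_mul_le N A B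
    have hn := fun (A : NCSeries L5 ℝ) => NCSeries.tn_nonneg N A
    refine (NCSeries.tn_add_le _ _ _).trans (add_le_add ?_ ?_)
    · rw [NCSeries.tn_neg]
      refine (NCSeries.tn_add_le _ _ _).trans (add_le_add ((NCSeries.tn_add_le _ _ _).trans (add_le_add ?_ ?_)) ?_)
      · calc NCSeries.tn N ((Fs3 s - Ms3 s) * (Fs2 s * Fs1 s))
            ≤ NCSeries.tn N (Fs3 s - Ms3 s) * (NCSeries.tn N (Fs2 s) * NCSeries.tn N (Fs1 s)) :=
              (T _ _).trans (mul_le_mul_of_nonneg_left (T _ _) (hn _))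
          _ = _ := by ring
      · calc NCSeries.tn N (Ms3 s * ((Fs2 s - Ms2 s) * Fs1 s))
            ≤ NCSeries.tn N (Ms3 s) * (NCSeries.tn N (Fs2 s - Ms2 s) * NCSeries.tn N (Fs1 s)) :=
              (T _ _).trans (mul_le_mul_of_nonneg_left (T _ _) (hn _))
          _ = _ := by ring
      · calc NCSeries.tn N (Ms3 s * (Ms2 s * (Fs1 s - Ms1 s)))
            ≤ NCSeries.tn N (Ms3 s) * (NCSeries.tn N (Ms2 s) * NCSeries.tn N (Fs1 s - Ms1 s)) :=
              (T _ _).trans (mul_le_mul_of_nonneg_left (T _ _) (hn _))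
          _ = _ := by ring
    · refine (NCSeries.tn_add_le _ _ _).trans (add_le_add ?_ (T _ _))
      calc NCSeries.tn N ((Fs4 s - Ms4 s) * Fs5 s) ≤ NCSeries.tn N (Fs4 s - Ms4 s) * NCSeries.tn N (Fs5 s) := T _ _
        _ = _ := by ring
  -- the total
  refine ((hmid.mul_polyBd q4).mul_polyBd q1).of_le (Eventually.of_forall fun s => ?_)
  rw [abs_of_nonneg (NCSeries.tn_nonneg _ _), Gtot]
  calc NCSeries.tn N (ns4 s * Gmid s * ns1 s) ≤ NCSeries.tn N (ns4 s * Gmid s) * NCSeries.tn N (ns1 s) :=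
        NCSeries.tn_mul_le _ _ _
    _ ≤ (NCSeries.tn N (ns4 s) * NCSeries.tn N (Gmid s)) * NCSeries.tn N (ns1 s) :=
        mul_le_mul_of_nonneg_right (NCSeries.tn_mul_le _ _ _) (NCSeries.tn_nonneg _ _)
    _ = NCSeries.tn N (ns1 s) * (NCSeries.tn N (ns4 s) * NCSeries.tn N (Gmid s)) := by ring

/-! ### Conclusion -/

/-- **Linear functionals of evaluations are controlled by the truncated norm.** [folklore] -/
theorem exists_dual_ev_le (lam : Module.Dual ℝ (A4 N)) :
    ∃ C : ℝ, ∀ G : NCSeries L5 ℝ, |lam (ev N G)| ≤ C * NCSeries.tn N G := by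
  classical
  refine ⟨∑ W ∈ NCSeries.wordsLE L5 N, |lam ((W.map (tOf N)).prod)|, fun G => ?_⟩
  set C := ∑ W ∈ NCSeries.wordsLE L5 N, |lam ((W.map (tOf N)).prod)| with hC
  have hCW : ∀ W ∈ NCSeries.wordsLE L5 N, |lam ((W.map (tOf N)).prod)| ≤ C := fun W hW =>
    Finset.single_le_sum (f := fun W => |lam ((W.map (tOf N)).prod)|) (fun _ _ => abs_nonneg _) hW
  have hev : ev N G = ∑ W ∈ NCSeries.wordsLE L5 N, G W • (W.map (tOf N)).prod :=
    NCSeries.evalTrunc_eq_sum_wordsLE N (tOf N) G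
  rw [hev, map_sum]
  simp only [map_smul, smul_eq_mul]
  calc |∑ W ∈ NCSeries.wordsLE L5 N, G W * lam ((W.map (tOf N)).prod)|
      ≤ ∑ W ∈ NCSeries.wordsLE L5 N, |G W * lam ((W.map (tOf N)).prod)| := Finset.abs_sum_le_sum_abs _ _
    _ ≤ ∑ W ∈ NCSeries.wordsLE L5 N, |G W| * C := Finset.sum_le_sum fun W hW => by
        rw [abs_mul]; exact mul_le_mul_of_nonneg_left (hCW W hW) (abs_nonneg _)
    _ = C * NCSeries.tn N G := by rw [NCSeries.tn, ← Finset.sum_mul, mul_comm]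

/-- **An element that is the evaluation of negligible series is zero.** [folklore] -/
theorem eq_zero_of_ev_negl {X : A4 N} {G : ℝ → NCSeries L5 ℝ} (hX : ∀ s, 1 ≤ s → X = ev N (G s))
    (hG : Negl fun s => NCSeries.tn N (G s)) : X = 0 := by
  refine (Module.forall_dual_apply_eq_zero_iff ℝ X).mp fun lam => ?_
  obtain ⟨C, hC⟩ := exists_dual_ev_le N lam
  refine eq_zero_of_abs_le_negl (hG.const_mul C) ?_
  filter_upwards [eventually_ge_atTop 1] with s hs
  rw [hX s hs]
  exact hC (G s)

/-- **The pentagon identity at level `N`.** [cite: Drinfeld1991, (2.13)] -/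
theorem sideY_eq_sideX : sideY N = sideX N := by
  have h : sideX N - sideY N = 0 :=
    eq_zero_of_ev_negl N (fun s hs => sideX_sub_sideY_eq_ev N hs) (negl_tn_Gtot N)
  exact (sub_eq_zero.mp h).symm

end Assembly

end KZPentagon

/-- **Drinfeld's theorem: `Φ_KZ` satisfies the pentagon equation** — the named fact
`drinfeldAssociator_pentagon` of `DrinfeldAssociator.lean` discharged. [cite: Drinfeld1991, (2.13);
Furusho2003, Rem. 4.3.2] -/
theorem drinfeldAssociator_pentagon_holds : drinfeldAssociator_pentagon := fun N =>
  KZPentagon.sideY_eq_sideX N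

end Literature.NumberTheory.Transcendental
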